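import Mathlib.LinearAlgebra.Matrix.Adjugate
import Mathlib.LinearAlgebra.Matrix.NonsingularInverse
import Mathlib.LinearAlgebra.Matrix.Block
import Mathlib.Algebra.Ring.GeomSum
import Mathlib.Data.Nat.Log
import Mathlib.Logic.Equiv.Fin.Basic
import Literature.Computability.AlgebraicComplexity.BinaryDeterminantalComplexity
import Literature.Computability.AlgebraicComplexity.DeterminantalComplexity
import Literature.Computability.AlgebraicComplexity.DeterminantalComplexityProofs
import Literature.Computability.AlgebraicComplexity.PermanentVsDeterminantProofs
import Literature.Computability.AlgebraicComplexity.ArithCircuit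
import Literature.Computability.AlgebraicComplexity.ValiantClasses
import Literature.Computability.AlgebraicComplexity.HamiltonianCycleVNP
import HarnessLib

/-!
# Binary determinantal complexity (Hüttenhain–Ikenmeyer 2016): §§1–2, §§5–6 typed as printed

Topic `Literature/Computability/AlgebraicComplexity`; cell val-lit (D-0074 GROUP L), DAG row
HI16-A, typer val-lit-t15. Typed literature: every numbered statement of the source outside the
computer proof of §§3–4 (whose results, Thm. 1.4 and Prop. 4.2, are ALREADY in the tree as the named
facts `huttenhainIkenmeyer2016_thm3`, `huttenhainIkenmeyer2016_prop9` of
`BinaryDeterminantalComplexity.lean` — cited here, not restated). Honest framing: `VP ≠ VNP` is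
not proved and nothing in this file is progress on it; these are upper bounds / universality
statements for a restricted model and one class equality.

**Source.** J. Hüttenhain, C. Ikenmeyer, *Binary determinantal complexity*, Linear Algebra
Appl. 504 (2016) 559–573 = arXiv:1410.8202v2 [HuttenhainIkenmeyer2016]. Locators below are
`§n` of the paper and `pNNNN:Lk` = chunk:line of the held text `paper:arxiv-1410.8202`
(`lit read arxiv:1410.8202`).

**Numbering (locator erratum fixed, docstrings only).** Statement numbers in this file are the
PRINTED ones of arXiv v2 (= the LAA sectioning; text of record, cell file
`lit/CROSSWALK-flat-numbering.md` § HI2016, printed headers `lit/pdftxt/HI2016/INDEX.tsv`). The held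
text's extractor flattens the per-section counters; the first version of this file (p418302–p421368)
and the DECLARATION NAMES use those flat chunk numbers, which stay as names: flat «Theorem 1» =
printed Thm. 1.1 (Valiant universality) · «Theorem 2» = **Thm. 1.3** (`huttenhainIkenmeyer2016_thm2`)
· «Theorem 3» = **Thm. 1.4** (`huttenhainIkenmeyer2016_thm3`, `bdc(per₃) = 7`) · «Observation 4» =
**Obs. 2.1** (`…_obs4`) · «Proposition 5» = **Prop. 2.2** (`…_prop5`, `…_prop5_holds`) ·
«Proposition 6» = **Prop. 2.3** (`…_prop6`, `…_prop6_holds`) · «Corollary 7» = **Cor. 2.4** (`…_cor7`,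
`…_cor7_holds`) · «Claim 8» = Claim 3.4 · «Proposition 9» = **Prop. 4.2** (`…_prop9`) · «Example 10» =
Ex. 4.3 · «Definition 11» = **Def. 5.1** · «Proposition 12» = **Prop. 5.2** (`…_prop12`) · «Remark 13»
= Rem. 5.3 · «Theorem 14» = **Thm. 6.1** (`…_thm14`, `…_thm14_holds`) · «Lemma 15» = **Lemma 6.2**
(`…_lemma15`). The chunk locators `pNNNN:Lk` are unchanged finding aids.

## Source item → declaration → status

| printed item | declaration | status |
|---|---|---|
| §1 "binary variable matrix" (p0003:L40) | `IsBinaryVariableMatrix` (BinaryDeterminantalComplexity.lean) | cited |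
| §1 "`bdc(f)` = smallest `n` …" (p0003:L43) | `HasBinaryDetRepr`, `binaryDetComplexity` | definitions |
| Thm. 1.1 (Valiant universality, integer form; p0003:L15) | `exists_isDetProjection` (DeterminantalComplexityProofs.lean, any commutative ring) | cited (proved in tree) |
| **Thm. 1.3** (binary Grenet: `per_m = det A`, `A` binary of size `2^m − 1`; p0003:L35) | `huttenhainIkenmeyer2016_thm2`, `binaryDetComplexity_perPoly_le` | **proved** |
| Thm. 1.4 (`bdc(per₃) = 7`; p0003:L54) | `huttenhainIkenmeyer2016_thm3` (cited fact) + bridge `binaryDetComplexity_perPoly_three` | fact cited; bridge proved |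
| §2 binary algebraic branching program, path value (p0004:L17) | `IsBinaryABP`, `pathValue` | definitions |
| Obs. 2.1 (value of a digraph = det of its adjacency matrix; p0004:L15) | `huttenhainIkenmeyer2016_obs4` | **proved** |
| **Prop. 2.2** (constant `c ≠ 0`: binary ABP with `O(log |c|)` vertices; p0004:L20) | `huttenhainIkenmeyer2016_prop5` (+ `_holds`, `K = 4`, ladder `HuttenhainIkenmeyer.ladder`) | named fact, **discharged** (`huttenhainIkenmeyer2016_prop5_holds`) |
| **Prop. 2.3** (integer variable matrix → binary, size `O(n² log |c_max|)`; p0004:L32) | `huttenhainIkenmeyer2016_prop6` (+ `_holds`, `K = 4`, `HuttenhainIkenmeyer.prop6Matrix`, Schur complement) | named fact, **discharged** (`huttenhainIkenmeyer2016_prop6_holds`) |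
| Cor. 2.4 (every `f ∈ ℤ[X]` is a binary determinant; p0005:L48) | `huttenhainIkenmeyer2016_cor7` (from Prop. 2.3, as printed), `huttenhainIkenmeyer2016_cor7_holds` (unconditional), `hasBinaryDetRepr_binaryDetComplexity` (`bdc` attained), `determinantalComplexity_le_binaryDetComplexity` | **proved** |
| Prop. 4.2 (uniqueness of Grenet's `7 × 7`; p0008:L21) | `huttenhainIkenmeyer2016_prop9` (cited fact) | cited |
| §5 skew circuit, `VP_s^0` (p0009:L10–L24); Def. 5.1 `DET^0` (p0009:L27) | `ArithCircuit.IsSkew`, `IsVPsZeroFamily`, `IsDETZeroFamily` | definitions |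
| **Prop. 5.2** (`VP_s^0 = DET^0`; p0009:L32) | `huttenhainIkenmeyer2016_prop12` | named fact |
| **Thm. 6.1** (`bdc(HC_{m+1}) ≤ m·2^{m−1} + 1`; p0010:L5) | `huttenhainIkenmeyer2016_thm14` (+ `_holds`, §6.2 `HuttenhainIkenmeyer.hcABP`) | named fact, **discharged** (`huttenhainIkenmeyer2016_thm14_holds`) |
| **Lemma 6.2** (binary ABP on `n ≥ 3` vertices with path value `±f` ⇒ binary matrix of size `n − 1` with det `f`; p0010:L13) | `huttenhainIkenmeyer2016_lemma15` | **proved** |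

Not typed: Claim 3.4 (an internal step of the computer search of §3.1), Example 4.3 (one of the 463
matrices with its `(g, h)`), Remark 5.3 (prose), the unnumbered remarks "sharp for `m = 1, 2`" and
"`bdc(per_m) ≥ m²/2` [MR04]", and the equality `VP_ws^0 = VP_s^0` attributed to [toda:92, Mal:03]
inside the proof of Prop. 5.2 (the weakly-skew notion is typed by val-lit-t16 with GKKP 2011).

## Rendering (design notes)

* **Digraphs as matrices.** A labelled digraph on the vertex set `V` (no parallel edges, loops
  allowed, §2 p0004:L7) IS its directed adjacency matrix `E : Matrix V V R` (`E u v` = label of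
  the edge `(u, v)`, `0` if absent; labels are `1` or variables, never `0`, so nothing is lost).
  A binary ABP (§2 p0004:L17: acyclic, labels `1` or a variable, source `s` without incoming and
  target `t` without outgoing edges) is the predicate `IsBinaryABP E s t`; acyclicity is rendered
  as the existence of a ranking `rk : V → ℕ` strictly increasing along edges (equivalent to
  acyclicity for finite digraphs). Its number of vertices is `Fintype.card V`.
* **Path value.** `(E ^ ℓ) s t` is the sum over the walks of length `ℓ` from `s` to `t` of the
  products of their labels; in an acyclic digraph without parallel edges these walks are exactly
  the `s`–`t`-paths with `ℓ` edges. Hence the printed path value (sum over `s`–`t`-paths of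
  `(−1)^{i−1} e_1 ⋯ e_i`, `i` = number of edges, p0004:L17) is
  `pathValue E s t = ∑_{ℓ < |V|} (−1)^ℓ (E^{ℓ+1}) s t` (a path has at most `|V| − 1` edges; the
  extra terms vanish, `HuttenhainIkenmeyer.pow_card_eq_zero`).
* **Lemma 6.2's matrix** ("identify `s` and `t` and add loops with label `1` to every other
  vertex") is `mergeMatrix E s t`, indexed by `{v // v ≠ t}`: the minor of `1 + E` deleting row
  `t` and column `s`, with column `t` renamed `s`. Its determinant is computed ALGEBRAICALLY
  (`det (1 + E) = 1`, `adjugate (1 + E) = ∑ (−E)^i`, a block decomposition) instead of by the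
  printed bijection cycle covers ↔ `s`–`t`-paths; same matrix, same size `n − 1`, same final row
  swap to fix the sign.
* **Theorem 1.3** is Lemma 6.2 applied to Grenet's branching program on the subsets of `Fin m`
  (arc `S → insert j S` labelled `X (j, |S|)`, the tree's convention `per_m = ∑_π ∏_i X_{π i, i}`;
  HI16's `x_{|S|+1, j}` up to the transposition `x_{ij} ↦ x_{ji}`, which fixes `per_m`), reusing
  `Grenet.adjugate_one_sub_empty_univ` of `PermanentVsDeterminantProofs.lean` (the tree's proof of
  `dc(per_m) ≤ 2^m − 1`, whose matrix has entries `0, ±1, ±X` and is therefore NOT binary —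
  the binary version needs HI16's sign convention, i.e. `1 + E` instead of `1 − A`).
* **`O(·)` constants (Props. 5, 6).** The source prints unspecified `O(log |c|)`,
  `O(n² · log |c_max|)`. We keep the constant existential (`∃ K`) and make the usual additive
  normalisation explicit: `K · (⌊log₂ |c|⌋ + 1)` resp. `n + K · n² · (⌊log₂ c_max⌋ + 1)` — read
  literally, `O(log |c|)` vertices is impossible for `|c| = 1` (`log 1 = 0`) and `O(n² log |c_max|)`
  is impossible for `c_max ≤ 1` (a matrix of size `≥ 1` is needed), while for `|c| ≥ 2`
  (resp. `n ≥ 1`, `c_max ≥ 2`) the two readings agree up to the constant. The normalised form is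
  exactly what the printed proofs give (Prop. 2.2: an addition chain by repeated squaring,
  subdivided; Prop. 2.3: induction on the number `q ≤ n²` of entries `∉ {0,1}`, each replaced by a
  program of Prop. 2.2, size `n + q · O(log |c_max|)`, p0004:L36).
* **Erratum noted (Prop. 2.2, proof, p0004:L29–L30), statement unaffected.** After subdividing
  every edge of the addition-chain digraph all `s`–`t`-paths have EVEN length, so with the
  printed sign convention `(−1)^{i−1}` the path value is `−c`, not `c` as printed; appending the
  extra edge `t → t'` of the first paragraph of the proof (printed there as the way to get `−c`)
  gives `+c`. Either way both signs are realised with `O(log |c|)` vertices.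
* **§5 classes.** HI16's circuits (p0009:L3–L24): fan-in-two `+`/`×` gates, inputs labelled by
  integers or variables, *constant-free* = inputs in `{1, −1} ∪ X`, *skew* = every multiplication
  gate has an input gate among its two parents, complexity = number of vertices. Rendered on the
  tree's `ArithCircuit` (list of gates with operands `var`/`const`/`gate`): `ArithCircuit.IsSkew`
  (every product gate has at most one operand referring to another gate), constant-freeness =
  the tree's `HasSignConstants` (constants and sum coefficients in `{0, 1, −1}`), size = number
  of gates. These differ from the printed measures by at most a constant factor (a weighted sum
  `u − v` costs one extra skew product by the input `−1`; vertices ≤ 3 · gates), so the CLASS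
  `VP_s^0` of families of polynomially bounded constant-free skew complexity is the same;
  `IsVPsZeroFamily` imposes no p-boundedness of the number of variables (the source does not).
  `DET^0` (Def. 5.1: "polynomially bounded `bdc`") is `IsDETZeroFamily f := ∃ s, IsPBounded s ∧
  ∀ n, HasBinaryDetRepr (f n) (s n)`, which avoids the junk value `sInf ∅ = 0` of
  `binaryDetComplexity` (never taken, by Cor. 2.4).
* `HC_{m+1}` is the tree's `hcPoly (Fin (m+1)) ℤ = ∑_{π an (m+1)-cycle} ∏_i X_{π i, i}`
  (StandardFamilies.lean), equal to HI16's `∑ ∏ x_{i, π(i)}` (p0009:L52) under `π ↦ π⁻¹`; for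
  `m = 0` the tree's `HC_1 = 0` while HI16 use `bdc(HC_1) = 1` (p0009:L57), and the bound of
  Thm. 6.1 (`= 1`) holds for both.

TYPER LINT: no `instance`, no `notation`, no attribute manipulation; existing declarations are
cited (`IsBinaryVariableMatrix`, `hiGrenet7`, `huttenhainIkenmeyer2016_thm3/_prop9`, `perPoly`,
`hcPoly`, `HasDetRepr`, `determinantalComplexity`, `IsDetProjection`, `exists_isDetProjection`,
`Grenet.*`, `ArithCircuit.*`, `IsPBounded`).

## References

* [HuttenhainIkenmeyer2016] J. Hüttenhain, C. Ikenmeyer, *Binary determinantal complexity*,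
  Linear Algebra Appl. 504 (2016) 559–573; arXiv:1410.8202v2. §1 (Thms. 1.1, 1.3, 1.4, `bdc`), §2
  (Obs. 2.1, Props. 2.2–2.3, Cor. 2.4), §5 (Def. 5.1, Prop. 5.2, Rem. 5.3), §6 (Thm. 6.1, Lemma 6.2).
* [Grenet2011] B. Grenet, *An upper bound for the permanent versus determinant problem* (2011).
* [ValiantSTOC1979] L. G. Valiant, *Completeness classes in algebra*, STOC 1979 (Thm. 1).
* S. Toda, *Classes of arithmetic circuits capturing the complexity of computing the
  determinant*, IEICE Trans. Inf. Syst. E75-D (1992); G. Malod, *Polynômes et coefficients*,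
  thèse, Lyon 2003 (`VP_ws = VP_s`, constant-free version) — cited by the source for Prop. 5.2.
-/

noncomputable section

open Matrix MvPolynomial Finset

namespace Literature.Computability.AlgebraicComplexity

universe u v

/-! ## §1. Binary determinantal complexity `bdc` -/

section Bdc

variable {σ : Type*}

/-- `HasBinaryDetRepr f n`: the integer polynomial `f` "can be written as a determinant of an
`n × n` binary variable matrix" (entries `0`, `1` or a variable; Hüttenhain–Ikenmeyer 2016, §1,
p0003:L40–L43). [cite: HuttenhainIkenmeyer2016, §1] -/
def HasBinaryDetRepr (f : MvPolynomial σ ℤ) (n : ℕ) : Prop :=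
  ∃ A : Matrix (Fin n) (Fin n) (MvPolynomial σ ℤ), IsBinaryVariableMatrix A ∧ A.det = f

/-- The **binary determinantal complexity** `bdc(f)`: "the smallest `n` such that `f` can be
written as a determinant of an `n × n` binary variable matrix" (Hüttenhain–Ikenmeyer 2016, §1,
p0003:L43). An `sInf` over `ℕ`; the junk value `0` for an empty set never occurs (Cor. 2.4,
`huttenhainIkenmeyer2016_cor7`), and `bdc 1 = 0` genuinely (empty determinant).
[cite: HuttenhainIkenmeyer2016, §1] -/
def binaryDetComplexity (f : MvPolynomial σ ℤ) : ℕ :=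
  sInf {n : ℕ | HasBinaryDetRepr f n}

/-- `bdc f ≤ n` as soon as `f` is the determinant of an `n × n` binary variable matrix
(definition of `bdc`, Hüttenhain–Ikenmeyer 2016, §1). [cite: HuttenhainIkenmeyer2016, §1] -/
theorem binaryDetComplexity_le_of_hasBinaryDetRepr {f : MvPolynomial σ ℤ} {n : ℕ}
    (h : HasBinaryDetRepr f n) : binaryDetComplexity f ≤ n :=
  Nat.sInf_le h

/-- Reindexing rows and columns of a binary variable matrix (e.g. permuting rows, padding
bijections) gives a binary variable matrix (immediate from the definition,
Hüttenhain–Ikenmeyer 2016, §1). [cite: HuttenhainIkenmeyer2016, §1] -/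
theorem IsBinaryVariableMatrix.submatrix {m l : Type*} {A : Matrix m m (MvPolynomial σ ℤ)}
    (hA : IsBinaryVariableMatrix A) (f g : l → m) : IsBinaryVariableMatrix (A.submatrix f g) :=
  fun i j => hA (f i) (g j)

/-- The entries of a binary variable matrix are affine linear forms (total degree `≤ 1`), so a
binary representation is an affine determinantal representation in the sense of
`IsAffineDetRepr` ("a stronger model of computation", Hüttenhain–Ikenmeyer 2016, §1, p0003:L49).
[cite: HuttenhainIkenmeyer2016, §1] -/
theorem IsBinaryVariableMatrix.totalDegree_le {m : Type*} {A : Matrix m m (MvPolynomial σ ℤ)}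
    (hA : IsBinaryVariableMatrix A) (i j : m) : (A i j).totalDegree ≤ 1 := by
  rcases hA i j with h | h | ⟨v, h⟩ <;> rw [h]
  · simp
  · simp
  · exact (totalDegree_X (R := ℤ) v).le

/-- A binary representation of size `n` is an affine determinantal representation of size `n`
over `ℤ`: `HasBinaryDetRepr f n → HasDetRepr f n`, whence `dc f ≤ bdc f` over `ℤ`
(Hüttenhain–Ikenmeyer 2016, §1: `dc` is "a stronger model of computation").
[cite: HuttenhainIkenmeyer2016, §1] -/
theorem HasBinaryDetRepr.hasDetRepr {f : MvPolynomial σ ℤ} {n : ℕ} (h : HasBinaryDetRepr f n) :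
    HasDetRepr f n := by
  obtain ⟨A, hA, hdet⟩ := h
  exact ⟨A, hA.totalDegree_le, hdet⟩

/-- `dc f ≤ n` for every binary representation of size `n` (over `ℤ`).
[cite: HuttenhainIkenmeyer2016, §1] -/
theorem determinantalComplexity_le_of_hasBinaryDetRepr {f : MvPolynomial σ ℤ} {n : ℕ}
    (h : HasBinaryDetRepr f n) : determinantalComplexity f ≤ n :=
  determinantalComplexity_le_of_hasDetRepr h.hasDetRepr

/-- Base change of a binary representation: over any commutative ring `k`, the image of a binary
variable matrix under `ℤ → k` is a matrix of affine linear forms with determinant the image of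
`f`; so `HasDetRepr (map (Int.castRingHom k) f) n` (e.g. `k = ℂ`, where the tree's `dc(per_m)`
statements live). [cite: HuttenhainIkenmeyer2016, §1] -/
theorem HasBinaryDetRepr.hasDetRepr_map {f : MvPolynomial σ ℤ} {n : ℕ} (h : HasBinaryDetRepr f n)
    (k : Type*) [CommRing k] : HasDetRepr (MvPolynomial.map (Int.castRingHom k) f) n := by
  obtain ⟨A, hA, hdet⟩ := h
  refine ⟨A.map (MvPolynomial.map (Int.castRingHom k)), fun i j => ?_, ?_⟩
  · rw [Matrix.map_apply]
    rcases hA i j with h | h | ⟨v, h⟩ <;> rw [h]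
    · simp
    · simp
    · rw [MvPolynomial.map_X]
      simpa [X, Finsupp.sum_single_index] using
        totalDegree_monomial_le (R := k) (Finsupp.single v 1) 1
  · rw [← RingHom.mapMatrix_apply, ← RingHom.map_det, hdet]

/-- A binary variable matrix with determinant `f` exhibits `f` as a Valiant projection of the
generic determinant `DET_n` over `ℤ` (entries are variables or the constants `0, 1`):
`HasBinaryDetRepr f n → IsDetProjection f n`. [cite: HuttenhainIkenmeyer2016, §1] -/
theorem HasBinaryDetRepr.isDetProjection {f : MvPolynomial σ ℤ} {n : ℕ}
    (h : HasBinaryDetRepr f n) : IsDetProjection f n := by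
  obtain ⟨A, hA, hdet⟩ := h
  refine ⟨fun p => A p.1 p.2, fun p => ?_, ?_⟩
  · show (∃ j, A p.1 p.2 = X j) ∨ ∃ c, A p.1 p.2 = C c
    rcases hA p.1 p.2 with h | h | ⟨v, h⟩
    · exact Or.inr ⟨0, by rw [h, C_0]⟩
    · exact Or.inr ⟨1, by rw [h, C_1]⟩
    · exact Or.inl ⟨v, h⟩
  · rw [detPoly, AlgHom.map_det, Matrix.mvPolynomialX_mapMatrix_aeval, hdet]

/-- Padding: a binary representation of size `n` gives one of every size `n' ≥ n` (block sum with
an identity matrix, whose entries `0, 1` are binary), so that `bdc(f)` = "the smallest `n`"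
(Hüttenhain–Ikenmeyer 2016, §1, p0003:L43) is also the threshold from which on representations
exist. [cite: HuttenhainIkenmeyer2016, §1] -/
theorem HasBinaryDetRepr.mono {f : MvPolynomial σ ℤ} {n n' : ℕ} (h : HasBinaryDetRepr f n)
    (hn : n ≤ n') : HasBinaryDetRepr f n' := by
  obtain ⟨A, hA, hdet⟩ := h
  obtain ⟨d, rfl⟩ := Nat.exists_eq_add_of_le hn
  refine ⟨Matrix.reindex finSumFinEquiv finSumFinEquiv
      (Matrix.fromBlocks A 0 0 (1 : Matrix (Fin d) (Fin d) (MvPolynomial σ ℤ))), ?_, ?_⟩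
  · intro i j
    rw [Matrix.reindex_apply, Matrix.submatrix_apply]
    rcases finSumFinEquiv.symm i with i' | i' <;> rcases finSumFinEquiv.symm j with j' | j'
    · exact hA i' j'
    · exact Or.inl rfl
    · exact Or.inl rfl
    · rw [Matrix.fromBlocks_apply₂₂, Matrix.one_apply]
      split_ifs
      · exact Or.inr (Or.inl rfl)
      · exact Or.inl rfl
  · rw [Matrix.det_reindex_self, Matrix.det_fromBlocks_zero₂₁, Matrix.det_one, mul_one, hdet]

/-- **Thm. 1.4 in `bdc` form** (bridge, proved from the cited fact): `bdc(per₃) = 7`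
(Hüttenhain–Ikenmeyer 2016, Thm. 1.4, p0003:L54) follows from `huttenhainIkenmeyer2016_thm3`
(no binary variable matrix of size `< 7` has determinant `per₃`, one of size `7` does).
[cite: HuttenhainIkenmeyer2016, Thm. 1.4] -/
theorem binaryDetComplexity_perPoly_three (h : huttenhainIkenmeyer2016_thm3) :
    binaryDetComplexity (perPoly (Fin 3) ℤ) = 7 := by
  obtain ⟨hlow, A, hA, hdet⟩ := h
  refine le_antisymm (binaryDetComplexity_le_of_hasBinaryDetRepr ⟨A, hA, hdet⟩) ?_
  by_contra hlt
  have hne : ({n : ℕ | HasBinaryDetRepr (perPoly (Fin 3) ℤ) n} : Set ℕ).Nonempty :=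
    ⟨7, A, hA, hdet⟩
  obtain ⟨B, hB, hBdet⟩ : HasBinaryDetRepr (perPoly (Fin 3) ℤ)
      (binaryDetComplexity (perPoly (Fin 3) ℤ)) := Nat.sInf_mem hne
  exact hlow _ (not_le.mp hlt) B hB hBdet

end Bdc

/-! ## §2. Digraphs, cycle covers, binary algebraic branching programs -/

section ABP

variable {V : Type*} [Fintype V] [DecidableEq V] {R : Type*} [CommRing R]

/-- **Observation 2.1** (Hüttenhain–Ikenmeyer 2016, §2, p0004:L15; [Val:79b]): "The value of a
digraph `G` equals the determinant of its directed adjacency matrix." Here a digraph on `V` with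
labels in `R` IS its directed adjacency matrix `A` (p0004:L11), a cycle cover is a permutation
`π` of `V` all of whose arcs `(i, π i)` are edges (covers through a non-edge have weight `0`), the
weight of a cycle with `i` edges `e_1, …, e_i` is `(−1)^{i−1} e_1 ⋯ e_i` (loops: `i = 1`) and the
weight of a cover is the product over its cycles (p0004:L9–L10): so the value is
`∑_π (∏_{c nontrivial cycle of π} (−1)^{|c|−1}) ∏_i A i (π i)`, and the observation is the
Leibniz formula with `sign π = ∏_c (−1)^{|c|−1}`. [cite: HuttenhainIkenmeyer2016, Obs. 2.1] -/
theorem huttenhainIkenmeyer2016_obs4 (A : Matrix V V R) :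
    A.det = ∑ π : Equiv.Perm V,
      (∏ c ∈ π.cycleFactorsFinset, (-1 : R) ^ (c.support.card - 1)) * ∏ i, A i (π i) := by
  rw [← Matrix.det_transpose, Matrix.det_apply']
  refine sum_congr rfl fun π _ => ?_
  simp only [Matrix.transpose_apply]
  congr 1
  rw [Equiv.Perm.sign_of_cycleType', Equiv.Perm.cycleType_def, Multiset.map_map,
    ← Finset.prod_eq_multiset_prod]
  push_cast
  refine prod_congr rfl fun c hc => ?_
  have h2 : 2 ≤ c.support.card :=
    (Equiv.Perm.mem_cycleFactorsFinset_iff.mp hc).1.two_le_card_support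
  obtain ⟨d, hd⟩ := Nat.exists_eq_add_of_le h2
  simp only [Function.comp_apply, hd, Units.val_neg, Units.val_pow_eq_pow_val, Units.val_one,
    Int.cast_neg, Int.cast_pow, Int.cast_one, show 2 + d - 1 = d + 1 from by omega]
  ring

/-- The **path value** of a labelled digraph `E` between `s` and `t` (Hüttenhain–Ikenmeyer 2016,
§2, p0004:L17): the sum over the `s`–`t`-paths of their path weights `(−1)^{i−1} e_1 ⋯ e_i`
(`i` edges with labels `e_1, …, e_i`; "this notion of weight differs from the literature by a
sign"). Rendered through powers of the adjacency matrix: `(E^ℓ) s t` is the sum over the walks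
of length `ℓ` from `s` to `t` of the products of their labels, and in an ACYCLIC digraph without
parallel edges (the only case in which the source uses the notion) these walks are exactly the
paths with `ℓ` edges, of which there are none with `ℓ ≥ |V|`. [cite: HuttenhainIkenmeyer2016, §2] -/
def pathValue (E : Matrix V V R) (s t : V) : R :=
  ∑ ℓ ∈ range (Fintype.card V), (-1) ^ ℓ * (E ^ (ℓ + 1)) s t

/-- A **binary algebraic branching program** `Γ = (Γ, s, t)` (Hüttenhain–Ikenmeyer 2016, §2,
p0004:L17): "an acyclic digraph where every edge is labeled by either `1` or a variable", with
"two distinguished vertices, the source `s` and the target `t`, where `s` has no incoming and `t`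
has no outgoing edges". The digraph on the vertex type `V` is given by its directed adjacency
(label) matrix `E` (`E u v = 0` iff there is no edge `(u, v)`); acyclicity = existence of a
ranking `rk : V → ℕ` strictly increasing along the edges. [cite: HuttenhainIkenmeyer2016, §2] -/
structure IsBinaryABP {σ : Type*} (E : Matrix V V (MvPolynomial σ ℤ)) (s t : V) : Prop where
  /-- every label is `1` or a variable (entries `0` = no edge) -/
  binary : IsBinaryVariableMatrix E
  /-- the digraph is acyclic: some ranking increases strictly along every edge -/
  acyclic : ∃ rk : V → ℕ, ∀ u v, E u v ≠ 0 → rk u < rk v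
  /-- source and target are two distinct distinguished vertices -/
  source_ne_target : s ≠ t
  /-- the source has no incoming edges -/
  eq_zero_to_source : ∀ u, E u s = 0
  /-- the target has no outgoing edges -/
  eq_zero_from_target : ∀ v, E t v = 0

/-- The alternating geometric sum `∑_{i < |V|} (−1)^i E^i` (= `(1 + E)⁻¹` for the adjacency
matrix of an acyclic digraph). [folklore] -/
def altPowSum (E : Matrix V V R) : Matrix V V R :=
  ∑ i ∈ range (Fintype.card V), (-1 : R) ^ i • E ^ i

/-- **Lemma 6.2's graph `G`** as a matrix (Hüttenhain–Ikenmeyer 2016, §6.1, proof of Lemma 6.2,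
p0010:L15): "identifying the two vertices `s` and `t` and adding loops with label `1` to every
other vertex". Indexed by the vertices `≠ t` (the merged vertex is called `s`): the entry
`(u, v)` is `(1 + E) u v` for `v ≠ s` (edges of `Γ`, plus the unit loops on the diagonal) and
`(1 + E) u t = E u t` for `v = s` (the edges into `t` now enter the merged vertex; `s` itself had
no incoming edges and gets no unit loop). [cite: HuttenhainIkenmeyer2016, Lemma 6.2 (proof)] -/
def mergeMatrix (E : Matrix V V R) (s t : V) : Matrix {v // v ≠ t} {v // v ≠ t} R :=
  Matrix.of fun u v => (1 + E) u.1 (if v.1 = s then t else v.1)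

namespace HuttenhainIkenmeyer

variable {E : Matrix V V R} {rk : V → ℕ}

/-- In a ranked (acyclic) digraph a nonzero entry of `E^ℓ` at `(u, v)` forces `rk u ≤ rk v` and
at least `ℓ` vertices of rank in `[rk u, rk v)` (the first `ℓ` vertices of a walk).
[folklore] -/
private theorem rank_le_of_pow_apply_ne_zero (hrk : ∀ u v, E u v ≠ 0 → rk u < rk v)
    (ℓ : ℕ) (u v : V) (h : (E ^ ℓ) u v ≠ 0) :
    rk u ≤ rk v ∧ ℓ ≤ (univ.filter fun x => rk u ≤ rk x ∧ rk x < rk v).card := by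
  induction ℓ generalizing v with
  | zero =>
    rw [pow_zero, Matrix.one_apply] at h
    have huv : u = v := by
      by_contra hne
      exact h (if_neg hne)
    subst huv
    exact ⟨le_rfl, Nat.zero_le _⟩
  | succ ℓ ih =>
    rw [pow_succ, Matrix.mul_apply] at h
    obtain ⟨w, -, hw⟩ := Finset.exists_ne_zero_of_sum_ne_zero h
    obtain ⟨huw, hcard⟩ := ih w (left_ne_zero_of_mul hw)
    have hwv : rk w < rk v := hrk w v (right_ne_zero_of_mul hw)
    refine ⟨huw.trans hwv.le, ?_⟩
    have hss : (univ.filter fun x => rk u ≤ rk x ∧ rk x < rk w) ⊂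
        (univ.filter fun x => rk u ≤ rk x ∧ rk x < rk v) := by
      rw [Finset.ssubset_iff_of_subset]
      · exact ⟨w, by simp [huw, hwv], by simp⟩
      · intro x hx
        simp only [mem_filter, mem_univ, true_and] at hx ⊢
        exact ⟨hx.1, hx.2.trans hwv⟩
    have := Finset.card_lt_card hss
    omega

/-- The adjacency matrix of a ranked (acyclic) digraph on `V` satisfies `E ^ |V| = 0` (no walk
has `|V|` edges). [folklore] -/
private theorem pow_card_eq_zero (hrk : ∀ u v, E u v ≠ 0 → rk u < rk v) :
    E ^ Fintype.card V = 0 := by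
  ext u v
  rw [Matrix.zero_apply]
  by_contra h
  obtain ⟨-, hle⟩ := rank_le_of_pow_apply_ne_zero hrk _ u v h
  have hlt : (univ.filter fun x => rk u ≤ rk x ∧ rk x < rk v).card < Fintype.card V := by
    rw [← Finset.card_univ]
    refine Finset.card_lt_card ((Finset.ssubset_iff_of_subset (subset_univ _)).mpr ?_)
    exact ⟨v, mem_univ _, by simp⟩
  omega

omit [Fintype V] [DecidableEq V] in
/-- A ranked digraph has no loops: `E v v = 0`. [folklore] -/
private theorem apply_self_eq_zero (hrk : ∀ u v, E u v ≠ 0 → rk u < rk v) (v : V) : E v v = 0 := by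
  by_contra h
  exact lt_irrefl _ (hrk v v h)

/-- `det (1 + E) = 1` for the adjacency matrix `E` of a ranked (acyclic) digraph: `1 + E` is
block upper-unitriangular for the ranking. [folklore] -/
private theorem det_one_add (hrk : ∀ u v, E u v ≠ 0 → rk u < rk v) : (1 + E).det = 1 := by
  have hzero : ∀ i j, rk j ≤ rk i → E i j = 0 := fun i j hle => by
    by_contra h
    exact absurd (hrk i j h) (not_lt.mpr hle)
  have hT : (1 + E).BlockTriangular rk := by
    intro i j hlt
    have hne : i ≠ j := by
      rintro rfl
      exact lt_irrefl _ hlt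
    rw [Matrix.add_apply, Matrix.one_apply_ne hne, hzero i j hlt.le, add_zero]
  rw [hT.det]
  refine prod_eq_one fun c _ => ?_
  rw [show (1 + E).toSquareBlock rk c = 1 from ?_, Matrix.det_one]
  ext ⟨i, hi⟩ ⟨j, hj⟩
  rw [Matrix.toSquareBlock_def, Matrix.of_apply, Matrix.add_apply, hzero i j (by rw [hi, hj]),
    add_zero, Matrix.one_apply, Matrix.one_apply]
  simp only [Subtype.mk.injEq]

/-- `altPowSum E = ∑_{i < |V|} (−E)^i`. [folklore] -/
private theorem altPowSum_eq (E : Matrix V V R) :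
    altPowSum E = ∑ i ∈ range (Fintype.card V), (-E) ^ i := by
  refine sum_congr rfl fun i _ => ?_
  rw [← neg_one_smul R E, smul_pow]

/-- `(1 + E) · ∑_{i<|V|} (−E)^i = 1 − (−E)^{|V|} = 1` for a ranked digraph. [folklore] -/
private theorem one_add_mul_altPowSum (hrk : ∀ u v, E u v ≠ 0 → rk u < rk v) :
    (1 + E) * altPowSum E = 1 := by
  rw [altPowSum_eq, ← sub_neg_eq_add, mul_neg_geom_sum, neg_pow, pow_card_eq_zero hrk, mul_zero,
    sub_zero]

/-- `adjugate (1 + E) = (1 + E)⁻¹ = ∑_{i<|V|} (−E)^i` for a ranked digraph (`det (1 + E) = 1`).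
[folklore] -/
private theorem adjugate_one_add (hrk : ∀ u v, E u v ≠ 0 → rk u < rk v) :
    (1 + E).adjugate = altPowSum E := by
  have hinv := Matrix.inv_eq_right_inv (one_add_mul_altPowSum hrk)
  rwa [Matrix.inv_def, det_one_add hrk, Ring.inverse_one, one_smul] at hinv

/-- For `s ≠ t`, the `(s, t)` entry of `adjugate (1 + E) = ∑_i (−1)^i E^i` is
`∑_{i ≥ 1} (−1)^i (E^i) s t = − pathValue E s t`. [folklore] -/
private theorem adjugate_one_add_apply (hrk : ∀ u v, E u v ≠ 0 → rk u < rk v) {s t : V} (hst : s ≠ t) :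
    (1 + E).adjugate s t = -pathValue E s t := by
  obtain ⟨k, hk⟩ : ∃ k, Fintype.card V = k + 1 :=
    Nat.exists_eq_add_one_of_ne_zero (Fintype.card_pos_iff.mpr ⟨s⟩).ne'
  have h0 : E ^ (k + 1) = 0 := hk ▸ pow_card_eq_zero hrk
  rw [adjugate_one_add hrk, altPowSum, Matrix.sum_apply, pathValue, hk, Finset.sum_range_succ',
    Finset.sum_range_succ, h0]
  simp only [Matrix.smul_apply, smul_eq_mul, pow_zero, pow_succ, Matrix.one_apply_ne hst,
    Matrix.zero_apply, mul_zero, add_zero]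
  rw [← Finset.sum_neg_distrib]
  refine sum_congr rfl fun i _ => ?_
  ring

/-- **The determinant of Lemma 6.2's matrix.** For `s ≠ t`,
`det (mergeMatrix E s t) = − adjugate (1 + E) s t`: replace row `t` of `1 + E` by the unit
vector `e_s` (`Matrix.adjugate_apply`), move column `s` to position `t` by the transposition
`(s t)` (sign `−1`), and expand the now block-triangular matrix along `{v ≠ t} ⊕ {t}`.
[cite: HuttenhainIkenmeyer2016, Lemma 6.2 (proof)] -/
theorem det_mergeMatrix (E : Matrix V V R) {s t : V} (hst : s ≠ t) :
    (mergeMatrix E s t).det = -(1 + E).adjugate s t := by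
  set M : Matrix V V R := 1 + E with hM
  rw [Matrix.adjugate_apply]
  set M' := M.updateRow t (Pi.single s 1) with hM'
  have hperm : (M'.submatrix id (Equiv.swap s t)).det = -M'.det := by
    rw [Matrix.det_permute', Equiv.Perm.sign_swap hst]
    simp
  set e := (Equiv.sumCompl fun v : V => v ≠ t) with he
  set N : Matrix ({v // v ≠ t} ⊕ {v // ¬v ≠ t}) ({v // v ≠ t} ⊕ {v // ¬v ≠ t}) R :=
    Matrix.reindex e.symm e.symm (M'.submatrix id (Equiv.swap s t)) with hN
  have hNdet : N.det = (M'.submatrix id (Equiv.swap s t)).det := Matrix.det_reindex_self _ _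
  have h21 : N.toBlocks₂₁ = 0 := by
    ext ⟨u, hu⟩ ⟨v, hv⟩
    have hut : u = t := not_not.mp hu
    subst hut
    simp only [hN, Matrix.toBlocks₂₁, Matrix.reindex_apply, Equiv.symm_symm,
      Matrix.submatrix_apply, Matrix.of_apply, he, Equiv.sumCompl_apply_inr,
      Equiv.sumCompl_apply_inl, id, hM', Matrix.updateRow_self, Matrix.zero_apply]
    rw [Pi.single_eq_of_ne]
    intro h
    rw [Equiv.swap_apply_eq_iff, Equiv.swap_apply_left] at h
    exact hv h
  have h11 : N.toBlocks₁₁ = mergeMatrix E s t := by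
    ext ⟨u, hu⟩ ⟨v, hv⟩
    simp only [hN, Matrix.toBlocks₁₁, Matrix.reindex_apply, Equiv.symm_symm,
      Matrix.submatrix_apply, Matrix.of_apply, he, Equiv.sumCompl_apply_inl, id, hM',
      Matrix.updateRow_ne hu, mergeMatrix, hM]
    rw [Equiv.swap_apply_def, if_neg hv]
  have h22 : N.toBlocks₂₂.det = 1 := by
    haveI : Subsingleton {v // ¬v ≠ t} :=
      ⟨fun a b => Subtype.ext ((not_not.mp a.2).trans (not_not.mp b.2).symm)⟩
    rw [Matrix.det_eq_elem_of_subsingleton _ ⟨t, not_not_intro rfl⟩]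
    simp only [hN, Matrix.toBlocks₂₂, Matrix.reindex_apply, Equiv.symm_symm,
      Matrix.submatrix_apply, Matrix.of_apply, he, Equiv.sumCompl_apply_inr, id, hM',
      Matrix.updateRow_self, Equiv.swap_apply_right, Pi.single_eq_same]
  have hblocks := Matrix.fromBlocks_toBlocks N
  rw [h21] at hblocks
  have hNdet' : N.det = (mergeMatrix E s t).det := by
    rw [← hblocks, Matrix.det_fromBlocks_zero₂₁, h11, h22, mul_one]
  rw [← hNdet', hNdet, hperm]

/-- For a ranked digraph and `s ≠ t`: `det (mergeMatrix E s t) = pathValue E s t` (the value of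
`G` is `±` the path value of `Γ`, Hüttenhain–Ikenmeyer 2016, proof of Lemma 6.2; here with the
sign determined). [cite: HuttenhainIkenmeyer2016, Lemma 6.2 (proof)] -/
theorem det_mergeMatrix_eq_pathValue (hrk : ∀ u v, E u v ≠ 0 → rk u < rk v) {s t : V}
    (hst : s ≠ t) : (mergeMatrix E s t).det = pathValue E s t := by
  rw [det_mergeMatrix E hst, adjugate_one_add_apply hrk hst, neg_neg]

end HuttenhainIkenmeyer

variable {σ : Type*}

omit [Fintype V] in
/-- Lemma 6.2's matrix of a binary ABP is a binary variable matrix (its entries are entries of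
`E`, or the unit loops `1 + E v v = 1`). [cite: HuttenhainIkenmeyer2016, Lemma 6.2 (proof)] -/
theorem isBinaryVariableMatrix_mergeMatrix {E : Matrix V V (MvPolynomial σ ℤ)}
    (hE : IsBinaryVariableMatrix E) (hdiag : ∀ v, E v v = 0) (s t : V) :
    IsBinaryVariableMatrix (mergeMatrix E s t) := by
  intro u v
  simp only [mergeMatrix, Matrix.of_apply, Matrix.add_apply]
  by_cases huw : u.1 = (if v.1 = s then t else v.1)
  · rw [← huw, Matrix.one_apply_eq, hdiag, add_zero]
    exact Or.inr (Or.inl rfl)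
  · rw [Matrix.one_apply_ne huw, zero_add]
    exact hE _ _

/-- **Lemma 6.2** (Hüttenhain–Ikenmeyer 2016, §6.1, p0010:L13): "Let `Γ = (Γ, s, t)` be a binary
algebraic branching program on `n ≥ 3` vertices with path value `±f`. Then, there is a binary
variable matrix of size `n − 1` whose determinant is equal to `f`." Proof as printed (identify
`s` and `t`, unit loops elsewhere: `mergeMatrix`; its determinant is `±f`; "since `n − 1 ≥ 2`,
we can exchange the first two rows … to change the sign"), with the cycle-cover count replaced
by `HuttenhainIkenmeyer.det_mergeMatrix_eq_pathValue`. [cite: HuttenhainIkenmeyer2016, Lemma 6.2] -/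
theorem huttenhainIkenmeyer2016_lemma15 {E : Matrix V V (MvPolynomial σ ℤ)} {s t : V}
    (hE : IsBinaryABP E s t) (h3 : 3 ≤ Fintype.card V) {f : MvPolynomial σ ℤ}
    (hf : pathValue E s t = f ∨ pathValue E s t = -f) :
    HasBinaryDetRepr f (Fintype.card V - 1) := by
  obtain ⟨rk, hrk⟩ := hE.acyclic
  have hdet : (mergeMatrix E s t).det = pathValue E s t :=
    HuttenhainIkenmeyer.det_mergeMatrix_eq_pathValue hrk hE.source_ne_target
  have hbin : IsBinaryVariableMatrix (mergeMatrix E s t) :=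
    isBinaryVariableMatrix_mergeMatrix hE.binary (HuttenhainIkenmeyer.apply_self_eq_zero hrk) s t
  have hcard : Fintype.card {v // v ≠ t} = Fintype.card V - 1 := by
    simp [Fintype.card_subtype_compl]
  obtain ⟨e⟩ : Nonempty ({v // v ≠ t} ≃ Fin (Fintype.card V - 1)) :=
    ⟨Fintype.equivFinOfCardEq hcard⟩
  rcases hf with hf | hf
  · refine ⟨Matrix.reindex e e (mergeMatrix E s t), hbin.submatrix _ _, ?_⟩
    rw [Matrix.det_reindex_self, hdet, hf]
  · obtain ⟨p, q, hpq⟩ : ∃ p q : {v // v ≠ t}, p ≠ q :=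
      Fintype.exists_pair_of_one_lt_card (by omega)
    refine ⟨Matrix.reindex e e ((mergeMatrix E s t).submatrix (Equiv.swap p q) id),
      (hbin.submatrix _ _).submatrix _ _, ?_⟩
    rw [Matrix.det_reindex_self, Matrix.det_permute, Equiv.Perm.sign_swap hpq, hdet, hf]
    simp

/-- **Proposition 2.2** (Hüttenhain–Ikenmeyer 2016, §2, p0004:L20), NAMED FACT: "For a nonzero
constant `c ∈ ℤ`, there is a binary algebraic branching program `Γ` with at most `O(log |c|)`
vertices whose path value is `c`." All labels of `Γ` are `1` (an addition chain for `|c|` by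
repeated squaring, every edge subdivided, plus one edge to adjust the sign — see the module
docstring for the parity slip in the printed proof, which does not affect the statement).
`O(log |c|)` is rendered as `≤ K · (⌊log₂ |c|⌋ + 1)` for a constant `K` independent of `c`
(module docstring, "`O(·)` constants"). Users take `(h : huttenhainIkenmeyer2016_prop5)`.
[cite: HuttenhainIkenmeyer2016, Prop. 2.2] -/
def huttenhainIkenmeyer2016_prop5 : Prop :=
  ∃ K : ℕ, ∀ c : ℤ, c ≠ 0 →
    ∃ (n : ℕ) (E : Matrix (Fin n) (Fin n) (MvPolynomial σ ℤ)) (s t : Fin n),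
      IsBinaryABP E s t ∧ (∀ u v, E u v = 0 ∨ E u v = 1) ∧
        n ≤ K * (Nat.log 2 c.natAbs + 1) ∧ pathValue E s t = C c

/-- **Proposition 2.3** (Hüttenhain–Ikenmeyer 2016, §2, p0004:L32), NAMED FACT: "Let `C` be an
`n × n` matrix whose entries are variables and arbitrary integer entries. Let `c_max` be the
integer entry of `C` with the largest absolute value. Then there is a binary variable matrix `A`
of size `O(n² · log |c_max|)` with `det(A) = det(C)`." Rendered with any bound `cmax` on the
absolute values of the integer entries (the conclusion is monotone in it) and the size bound in
the normalised form `N ≤ n + K · n² · (⌊log₂ cmax⌋ + 1)` that the printed induction on the number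
`q ≤ n²` of entries `∉ {0, 1}` yields (p0004:L36: "a binary variable matrix of size
`n + q · O(log |c_max|)`"); see the module docstring, "`O(·)` constants". Users take
`(h : huttenhainIkenmeyer2016_prop6)`. [cite: HuttenhainIkenmeyer2016, Prop. 2.3] -/
def huttenhainIkenmeyer2016_prop6 : Prop :=
  ∃ K : ℕ, ∀ (n cmax : ℕ) (M : Matrix (Fin n) (Fin n) (MvPolynomial σ ℤ)),
    (∀ i j, (∃ v, M i j = X v) ∨ ∃ c : ℤ, M i j = C c ∧ c.natAbs ≤ cmax) →
      ∃ N, N ≤ n + K * n ^ 2 * (Nat.log 2 cmax + 1) ∧ HasBinaryDetRepr M.det N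

/-- **Corollary 2.4** (Hüttenhain–Ikenmeyer 2016, §2, p0005:L48): "For every polynomial `f` with
integer coefficients there exists a binary variable matrix whose determinant is `f`." Proof as
printed — "Combine Theorem 1.1 and Proposition 2.3": Theorem 1.1 (Valiant's universality in its
integer/projection form) is the tree's `exists_isDetProjection` over `ℤ` (entries variables or
integer constants), and Proposition 2.3 is taken as the hypothesis `h6`.
[cite: HuttenhainIkenmeyer2016, Cor. 2.4] -/
theorem huttenhainIkenmeyer2016_cor7 (h6 : huttenhainIkenmeyer2016_prop6 (σ := σ))
    (f : MvPolynomial σ ℤ) : ∃ n, HasBinaryDetRepr f n := by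
  classical
  obtain ⟨K, hK⟩ := h6
  obtain ⟨m, a, ha, hf⟩ := exists_isDetProjection f
  -- Theorem 1.1: the integer variable matrix `M = (a (i, j))` has `det M = f`
  set M : Matrix (Fin m) (Fin m) (MvPolynomial σ ℤ) := Matrix.of fun i j => a (i, j) with hM
  have hdet : M.det = f := by
    rw [hf, detPoly, AlgHom.map_det, show a = fun p : Fin m × Fin m => M p.1 p.2 from rfl,
      Matrix.mvPolynomialX_mapMatrix_aeval]
  -- a bound on the absolute values of the integer entries
  let cst : Fin m × Fin m → ℕ := fun p => if h : ∃ c : ℤ, a p = C c then h.choose.natAbs else 0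
  obtain ⟨N, -, hN⟩ := hK m (univ.sup cst) M fun i j => by
    rcases ha (i, j) with ⟨v, hv⟩ | ⟨c, hc⟩
    · exact Or.inl ⟨v, hv⟩
    · right
      have hex : ∃ c : ℤ, a (i, j) = C c := ⟨c, hc⟩
      refine ⟨hex.choose, hex.choose_spec, ?_⟩
      have hcst : cst (i, j) = hex.choose.natAbs := dif_pos hex
      rw [← hcst]
      exact Finset.le_sup (f := cst) (mem_univ _)
  exact ⟨N, hdet ▸ hN⟩

/-! ### Grenet's branching program for the permanent (§6.1) and Theorem 1.3 -/

/-- The label `X (j, c)` of an arc of Grenet's program leaving a subset of cardinality `c`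
towards `insert j _` (junk `0` for `c ≥ m`, never used). [cite: HuttenhainIkenmeyer2016, §6.1] -/
def grenetWeight (m : ℕ) (j : Fin m) (c : ℕ) : MvPolynomial (Fin m × Fin m) ℤ :=
  if h : c < m then X (j, ⟨c, h⟩) else 0

/-- **Grenet's construction** (Hüttenhain–Ikenmeyer 2016, §6.1, p0010:L11; Grenet 2011): the
binary algebraic branching program on the `2^m` subsets of `Fin m` with an edge
`S → insert j S` for `j ∉ S`, labelled by the variable `X (j, |S|)` (the tree's convention
`per_m = ∑_π ∏_i X_{π i, i}`; the source labels it `x_{|S|+1, j}`), source `∅`, target `univ`;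
as its directed adjacency matrix. [cite: HuttenhainIkenmeyer2016, §6.1] -/
def grenetABP (m : ℕ) :
    Matrix (Finset (Fin m)) (Finset (Fin m)) (MvPolynomial (Fin m × Fin m) ℤ) :=
  Matrix.of fun S T => ∑ j, if j ∉ S ∧ T = insert j S then grenetWeight m j S.card else 0

/-- Entries of `grenetABP` (unfolding). [cite: HuttenhainIkenmeyer2016, §6.1] -/
theorem grenetABP_apply (m : ℕ) (S T : Finset (Fin m)) :
    grenetABP m S T = ∑ j, if j ∉ S ∧ T = insert j S then grenetWeight m j S.card else 0 := rfl

/-- Grenet's program is a binary ABP for `m ≥ 1` (labels are variables; ranking by cardinality;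
`∅ ≠ univ`; nothing enters `∅` or leaves `univ`). [cite: HuttenhainIkenmeyer2016, §6.1] -/
theorem isBinaryABP_grenetABP (m : ℕ) (hm : 1 ≤ m) : IsBinaryABP (grenetABP m) ∅ univ where
  binary := by
    intro S T
    by_cases h : ∃ j, j ∉ S ∧ T = insert j S
    · obtain ⟨j, hj, rfl⟩ := h
      have heq : grenetABP m S (insert j S) = grenetWeight m j S.card := by
        rw [grenetABP_apply, Finset.sum_eq_single j]
        · rw [if_pos ⟨hj, rfl⟩]
        · intro j' _ hj'
          rw [if_neg]
          rintro ⟨-, heq⟩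
          exact hj' ((Finset.insert_inj hj).mp heq).symm
        · intro h
          exact absurd (mem_univ j) h
      rw [heq, grenetWeight]
      split_ifs
      · exact Or.inr (Or.inr ⟨_, rfl⟩)
      · exact Or.inl rfl
    · left
      rw [grenetABP_apply]
      exact sum_eq_zero fun j _ => if_neg fun hj => h ⟨j, hj⟩
  acyclic := ⟨Finset.card, fun S T hST => by
      rw [grenetABP_apply] at hST
      obtain ⟨j, -, hj⟩ := exists_ne_zero_of_sum_ne_zero hST
      have hc : j ∉ S ∧ T = insert j S := by
        by_contra hc
        exact hj (if_neg hc)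
      rw [hc.2, card_insert_of_notMem hc.1]
      exact Nat.lt_succ_self _⟩
  source_ne_target := by
    haveI : Nonempty (Fin m) := ⟨⟨0, hm⟩⟩
    exact Finset.univ_nonempty.ne_empty.symm
  eq_zero_to_source := fun S => by
    rw [grenetABP_apply]
    exact sum_eq_zero fun j _ => if_neg fun h => Finset.insert_ne_empty j S h.2.symm
  eq_zero_from_target := fun T => by
    rw [grenetABP_apply]
    exact sum_eq_zero fun j _ => if_neg fun h => h.1 (mem_univ j)

/-- **The path value of Grenet's program is `±per_m`** (Hüttenhain–Ikenmeyer 2016, §6.1,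
p0010:L11: "the path value … is equal to `(−1)^{m−1} · per_m`"): via
`Grenet.adjugate_one_sub_empty_univ` applied to the negated labels (`1 + E = 1 − (−E)`) and
`HuttenhainIkenmeyer.adjugate_one_add_apply`. [cite: HuttenhainIkenmeyer2016, §6.1] -/
theorem pathValue_grenetABP (m : ℕ) (hm : 1 ≤ m) :
    pathValue (grenetABP m) ∅ univ = (-1) ^ (m + 1) * perPoly (Fin m) ℤ := by
  have hA : ∀ S T, (-grenetABP m) S T =
      ∑ j, if j ∉ S ∧ T = insert j S then (fun j c => -grenetWeight m j c) j S.card else 0 := by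
    intro S T
    rw [Matrix.neg_apply, grenetABP_apply, ← sum_neg_distrib]
    refine sum_congr rfl fun j _ => ?_
    split_ifs <;> simp
  have hadj := Grenet.adjugate_one_sub_empty_univ (fun j c => -grenetWeight m j c) hA
  rw [sub_neg_eq_add, Grenet.sum_ite_injective] at hadj
  obtain ⟨rk, hrk⟩ := (isBinaryABP_grenetABP m hm).acyclic
  have h2 := HuttenhainIkenmeyer.adjugate_one_add_apply hrk
    (isBinaryABP_grenetABP m hm).source_ne_target
  rw [hadj] at h2
  have h3 : pathValue (grenetABP m) ∅ univ =
      -∑ σ : Equiv.Perm (Fin m), ∏ t, -grenetWeight m (σ t) t := by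
    rw [h2, neg_neg]
  rw [h3, perPoly, Matrix.permanent, Finset.mul_sum, ← sum_neg_distrib]
  refine sum_congr rfl fun σ _ => ?_
  rw [Finset.prod_neg, card_univ, Fintype.card_fin, pow_succ]
  have hw : ∀ t : Fin m,
      grenetWeight m (σ t) t = Matrix.mvPolynomialX (Fin m) (Fin m) ℤ (σ t) t := by
    intro t
    rw [grenetWeight, dif_pos t.isLt, Matrix.mvPolynomialX_apply]
  simp only [hw]
  ring

/-- **Theorem 1.3** (Hüttenhain–Ikenmeyer 2016, §1, p0003:L35; Grenet 2011): "For every natural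
number `m` there exists an integer variable matrix `A` of size `2^m − 1` such that
`per_m = det(A)`. Moreover, `A` can be chosen such that the entries in `A` are only variables,
zeros, and ones, but no other constants." For `m ≥ 2` this is Lemma 6.2 applied to Grenet's
program (`2^m ≥ 3` vertices); `m = 0, 1` directly (`per_0 = 1 = det ()`, `per_1 = x_{11}`).
[cite: HuttenhainIkenmeyer2016, Thm. 1.3] -/
theorem huttenhainIkenmeyer2016_thm2 (m : ℕ) :
    HasBinaryDetRepr (perPoly (Fin m) ℤ) (2 ^ m - 1) := by
  rcases Nat.lt_or_ge m 2 with hm | hm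
  · interval_cases m
    · refine ⟨Matrix.of fun _ _ => 0, fun i => i.elim0, ?_⟩
      simp [perPoly, Matrix.permanent]
    · refine ⟨Matrix.of fun _ _ => X (0, 0), fun _ _ => Or.inr (Or.inr ⟨_, rfl⟩), ?_⟩
      simp [perPoly, Matrix.permanent, Matrix.det_unique, Matrix.mvPolynomialX_apply]
  · have h1 : 1 ≤ m := by omega
    have hcard : Fintype.card (Finset (Fin m)) = 2 ^ m := by simp
    have h3 : 3 ≤ Fintype.card (Finset (Fin m)) := by
      rw [hcard]
      calc 3 ≤ 2 ^ 2 := by norm_num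
        _ ≤ 2 ^ m := Nat.pow_le_pow_right (by norm_num) hm
    have key := huttenhainIkenmeyer2016_lemma15 (isBinaryABP_grenetABP m h1) h3
      (f := perPoly (Fin m) ℤ) ?_
    · rwa [hcard] at key
    · rw [pathValue_grenetABP m h1]
      rcases neg_one_pow_eq_or (MvPolynomial (Fin m × Fin m) ℤ) (m + 1) with h | h <;> simp [h]

/-- "Theorem 1.3 shows that `bdc(per_m) ≤ 2^m − 1`" (Hüttenhain–Ikenmeyer 2016, §1, p0003:L47).
[cite: HuttenhainIkenmeyer2016, Thm. 1.3] -/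
theorem binaryDetComplexity_perPoly_le (m : ℕ) :
    binaryDetComplexity (perPoly (Fin m) ℤ) ≤ 2 ^ m - 1 :=
  binaryDetComplexity_le_of_hasBinaryDetRepr (huttenhainIkenmeyer2016_thm2 m)

/-- **Theorem 6.1** (Hüttenhain–Ikenmeyer 2016, §6, p0010:L5), NAMED FACT: "For all natural
numbers `m ∈ ℕ`, we have `bdc(HC_{m+1}) ≤ m · 2^{m−1} + 1`" (§6.2: a binary ABP with a vertex
`v_{(I,i)}` for every nonempty `I ⊆ [m]`, `i ∈ I`, plus `s, t`, i.e. `m 2^{m−1} + 2` vertices,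
whose `s`–`t`-paths are the `(m+1)`-cycles; then Lemma 6.2). `HC_{m+1}` is the tree's
`hcPoly (Fin (m+1)) ℤ` (module docstring: for `m = 0` it is `0`, the source's `HC_1` is `x_{11}`;
the bound `1` holds for both). The exponent `m − 1` is natural subtraction, harmless at `m = 0`
where the factor `m` vanishes (value `1`, as printed). Stated as `HasBinaryDetRepr`, which gives
`bdc ≤` by `binaryDetComplexity_le_of_hasBinaryDetRepr`. Users take
`(h : huttenhainIkenmeyer2016_thm14)`. [cite: HuttenhainIkenmeyer2016, Thm. 6.1] -/
def huttenhainIkenmeyer2016_thm14 : Prop :=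
  ∀ m : ℕ, HasBinaryDetRepr (hcPoly (Fin (m + 1)) ℤ) (m * 2 ^ (m - 1) + 1)

end ABP

/-! ## §5. Algebraic complexity classes: skew circuits, `VP_s^0`, `DET^0`, Proposition 5.2 -/

namespace ArithCircuit

variable {k : Type u} {τ : Type v}

/-- An operand of a gate is a reference to (the value of) another gate, as opposed to an input
(a variable or a constant) (Hüttenhain–Ikenmeyer 2016, §5, p0009:L5: "input gates").
[cite: HuttenhainIkenmeyer2016, §5] -/
def Operand.isGateRef : Operand k τ → Bool
  | .gate _ => true
  | _ => false

/-- A gate is **skew** if it is a sum gate, or a product gate at most one of whose operands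
refers to another gate — for fan-in-two product gates: "at least one of its two parents is an
input gate" (Hüttenhain–Ikenmeyer 2016, §5, p0009:L11). [cite: HuttenhainIkenmeyer2016, §5] -/
def Gate.IsSkew : Gate k τ → Prop
  | .prod args => args.countP Operand.isGateRef ≤ 1
  | .sum _ => True

/-- A circuit is **skew** if every multiplication gate is skew (Hüttenhain–Ikenmeyer 2016, §5,
p0009:L11: "An algebraic circuit is called skew if for every multiplication gate at least one of
its two parents is an input gate"; Toda 1992). [cite: HuttenhainIkenmeyer2016, §5] -/
def IsSkew (P : ArithCircuit k τ) : Prop :=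
  ∀ g ∈ P.gates, g.IsSkew

end ArithCircuit

section Classes

variable {ς : ℕ → Type*}

/-- **`VP_s^0`** (Hüttenhain–Ikenmeyer 2016, §5, p0009:L22; Malod 2003): "the set of sequences of
polynomials with polynomially bounded constant-free skew complexity", the constant-free skew
complexity of `f` being the least size of a constant-free (inputs `1`, `−1` or variables) skew
circuit computing `f`. Rendered on the tree's `ArithCircuit`: fan-in two, `HasSignConstants`
(constants and sum coefficients in `{0, 1, −1}`), `IsSkew`, size = number of gates — the same
class (module docstring, "§5 classes"). No p-boundedness of the number of variables is imposed
(the source imposes none). [cite: HuttenhainIkenmeyer2016, §5] -/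
def IsVPsZeroFamily (f : ∀ n, MvPolynomial (ς n) ℤ) : Prop :=
  ∃ P : ∀ n, ArithCircuit ℤ (ς n),
    (∀ n, (P n).IsFanInTwo ∧ (P n).HasSignConstants ∧ (P n).IsSkew ∧ (P n).Computes (f n)) ∧
      IsPBounded fun n => (P n).size

/-- **Definition 5.1, the class `DET^0`** (Hüttenhain–Ikenmeyer 2016, §5, p0009:L27): "all
sequences of polynomials that have polynomially bounded binary determinantal complexity `bdc`".
Rendered as the existence of a polynomially bounded size function `s` with binary
representations of size `s n` (equivalent to `IsPBounded (bdc ∘ f)` since `bdc` is never the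
junk value `0`, Cor. 2.4; this form does not depend on that). [cite: HuttenhainIkenmeyer2016, Def. 5.1] -/
def IsDETZeroFamily (f : ∀ n, MvPolynomial (ς n) ℤ) : Prop :=
  ∃ s : ℕ → ℕ, IsPBounded s ∧ ∀ n, HasBinaryDetRepr (f n) (s n)

/-- A `DET^0` family has polynomially bounded `bdc` (the printed wording of Def. 5.1).
[cite: HuttenhainIkenmeyer2016, Def. 5.1] -/
theorem IsDETZeroFamily.isPBounded_binaryDetComplexity {f : ∀ n, MvPolynomial (ς n) ℤ}
    (hf : IsDETZeroFamily f) : IsPBounded fun n => binaryDetComplexity (f n) := by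
  obtain ⟨s, ⟨c, hc⟩, hs⟩ := hf
  exact ⟨c, fun n => (binaryDetComplexity_le_of_hasBinaryDetRepr (hs n)).trans (hc n)⟩

/-- **Proposition 5.2** (Hüttenhain–Ikenmeyer 2016, §5, p0009:L32), NAMED FACT: "`VP_s^0 = DET^0`."
(Proof in the source: `DET^0 ⊆ VP_s^0` by [toda:92]; conversely Toda's construction turns a skew
circuit into a matrix with entries variables and `0, 1, −1`, and Prop. 2.3 makes it binary; the
source also records `DET^0 = VP_s^0 = VP_ws^0`, the weakly-skew class, not typed here.) Users
take `(h : huttenhainIkenmeyer2016_prop12)`. [cite: HuttenhainIkenmeyer2016, Prop. 5.2] -/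
def huttenhainIkenmeyer2016_prop12 : Prop :=
  ∀ f : ∀ n, MvPolynomial (ς n) ℤ, IsVPsZeroFamily f ↔ IsDETZeroFamily f

end Classes

/-! ## §6.2. The Hamiltonian cycle polynomial: proof of Theorem 6.1

Hüttenhain–Ikenmeyer 2016, §6.2 (p0010:L17–p0011): for `HC_{m+1}` a binary algebraic branching
program with the vertices `s`, `t` and `v_{(I,i)}` for every nonempty `I ⊆ [m]` and `i ∈ I`;
edges `s → v_{({i},i)}` labelled `x_{m+1,i}`, `v_{(I,i)} → v_{(I ∪ {j}, j)}` labelled `x_{i,j}`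
for `j ∈ [m] ∖ I`, and `v_{([m],i)} → t` labelled `x_{i,m+1}`; its `s`–`t`-paths are the
`(m+1)`-cycles `(a_1, …, a_m, m+1)`, all of length `m + 1`, so the path value is `±HC_{m+1}` and
Lemma 6.2 gives a binary variable matrix of size `m 2^{m−1} + 1`. We render `HC_{n}` for
`n = m' + 2` on the vertex set `Fin (m'+2)` with the distinguished vertex `0` in the role of the
source's `m+1` and the arc `b → a` carrying the tree's variable `X (a, b)` (so that the path of the
ordering `0 = σ 0, σ 1, …, σ (m'+1)` has weight `∏_t X (σ (t+1), σ t)`, the summand of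
`hamiltonianCycleSum_eq_sum_orderings`); the source `s` is realised as the virtual pair `(∅, 0)`,
which makes the edge rule uniform. -/

section HC

namespace HuttenhainIkenmeyer

variable (m : ℕ)

/-- The vertices `v_{(I,i)}` (`i ∈ I ⊆ [m]`, here `I ⊆ Fin (m+2) ∖ {0}`) of the program of
Hüttenhain–Ikenmeyer 2016, §6.2 (p0010:L27), together with the source `s`, encoded as the pair
`(∅, 0)`. [cite: HuttenhainIkenmeyer2016, Thm. 6.1 (proof)] -/
abbrev HCVert : Type :=
  {p : Finset (Fin (m + 2)) × Fin (m + 2) // (p.2 ∈ p.1 ∧ (0 : Fin (m + 2)) ∉ p.1) ∨ p = (∅, 0)}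

/-- The source `s = (∅, 0)` of the program of §6.2. [cite: HuttenhainIkenmeyer2016, Thm. 6.1 (proof)] -/
def hcSource : HCVert m := ⟨(∅, 0), Or.inr rfl⟩

/-- **The binary ABP for `HC_{m'+2}`** (Hüttenhain–Ikenmeyer 2016, §6.2, p0010:L31–L36) as its
adjacency matrix on `HCVert m ⊕ Unit` (the extra vertex is the target `t`): edges
`(I, i) → (insert j I, j)` for `j ∉ I` labelled `X (j, i)` (this covers the source edges
`(∅,0) → ({j}, j)`, label `X (j, 0)`), and `(univ ∖ {0}, i) → t` labelled `X (0, i)`.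
[cite: HuttenhainIkenmeyer2016, Thm. 6.1 (proof)] -/
def hcABP : Matrix (HCVert m ⊕ Unit) (HCVert m ⊕ Unit) (MvPolynomial (Fin (m + 2) × Fin (m + 2)) ℤ) :=
  Matrix.of fun u v =>
    match u, v with
    | Sum.inl w, Sum.inl w' =>
        if w'.1.2 ∉ w.1.1 ∧ w'.1.1 = insert w'.1.2 w.1.1 then X (w'.1.2, w.1.2) else 0
    | Sum.inl w, Sum.inr _ => if w.1.1 = univ.erase 0 then X (0, w.1.2) else 0
    | Sum.inr _, _ => 0

/-- Internal edges of `hcABP`. [cite: HuttenhainIkenmeyer2016, Thm. 6.1 (proof)] -/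
theorem hcABP_inl_inl (w w' : HCVert m) :
    hcABP m (Sum.inl w) (Sum.inl w') =
      if w'.1.2 ∉ w.1.1 ∧ w'.1.1 = insert w'.1.2 w.1.1 then X (w'.1.2, w.1.2) else 0 := rfl

/-- Edges of `hcABP` into the target. [cite: HuttenhainIkenmeyer2016, Thm. 6.1 (proof)] -/
theorem hcABP_inl_inr (w : HCVert m) (u : Unit) :
    hcABP m (Sum.inl w) (Sum.inr u) = if w.1.1 = univ.erase 0 then X (0, w.1.2) else 0 := rfl

/-- The target of `hcABP` has no outgoing edges. [cite: HuttenhainIkenmeyer2016, Thm. 6.1 (proof)] -/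
theorem hcABP_inr (u : Unit) (v : HCVert m ⊕ Unit) : hcABP m (Sum.inr u) v = 0 := by
  rcases v with _ | _ <;> rfl

/-- No vertex `(I, i)` of the program contains `0` in `I`. [cite: HuttenhainIkenmeyer2016, Thm. 6.1 (proof)] -/
theorem HCVert.zero_not_mem (w : HCVert m) : (0 : Fin (m + 2)) ∉ w.1.1 := by
  rcases w.2 with h | h
  · exact h.2
  · rw [h]
    exact Finset.notMem_empty _

/-- `hcABP` is a binary algebraic branching program (labels are variables; ranking by `|I|`,
target on top). [cite: HuttenhainIkenmeyer2016, Thm. 6.1 (proof)] -/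
theorem isBinaryABP_hcABP : IsBinaryABP (hcABP m) (Sum.inl (hcSource m)) (Sum.inr ()) where
  binary := by
    rintro (w | u) (w' | u')
    · rw [hcABP_inl_inl]
      split_ifs
      · exact Or.inr (Or.inr ⟨_, rfl⟩)
      · exact Or.inl rfl
    · rw [hcABP_inl_inr]
      split_ifs
      · exact Or.inr (Or.inr ⟨_, rfl⟩)
      · exact Or.inl rfl
    · exact Or.inl (hcABP_inr m u _)
    · exact Or.inl (hcABP_inr m u _)
  acyclic := by
    refine ⟨Sum.elim (fun w => w.1.1.card) (fun _ => m + 2), ?_⟩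
    rintro (w | u) (w' | u') h
    · rw [hcABP_inl_inl] at h
      have hc : w'.1.2 ∉ w.1.1 ∧ w'.1.1 = insert w'.1.2 w.1.1 := by
        by_contra hc
        exact h (if_neg hc)
      simp only [Sum.elim_inl]
      rw [hc.2, card_insert_of_notMem hc.1]
      exact Nat.lt_succ_self _
    · rw [hcABP_inl_inr] at h
      have hc : w.1.1 = univ.erase 0 := by
        by_contra hc
        exact h (if_neg hc)
      simp only [Sum.elim_inl, Sum.elim_inr]
      rw [hc, card_erase_of_mem (mem_univ _), card_univ, Fintype.card_fin]
      omega
    · exact absurd (hcABP_inr m u _) h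
    · exact absurd (hcABP_inr m u _) h
  source_ne_target := Sum.inl_ne_inr
  eq_zero_to_source := by
    rintro (w | u)
    · rw [hcABP_inl_inl, if_neg]
      rintro ⟨-, h⟩
      exact Finset.insert_ne_empty _ _ h.symm
    · exact hcABP_inr m u _
  eq_zero_from_target := fun v => hcABP_inr m () v

/-- The weight `∏_{t<k} X (c (t+1), c t)` of the path `c = (i, g 0, g 1, …, g (k-1))`.
[cite: HuttenhainIkenmeyer2016, Thm. 6.1 (proof)] -/
def consWeight (k : ℕ) (i : Fin (m + 2)) (g : Fin k → Fin (m + 2)) :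
    MvPolynomial (Fin (m + 2) × Fin (m + 2)) ℤ :=
  ∏ t : Fin k, X ((Fin.cons i g : Fin (k + 1) → Fin (m + 2)) t.succ,
    (Fin.cons i g : Fin (k + 1) → Fin (m + 2)) t.castSucc)

/-- Peeling the first arc off a path weight. [cite: HuttenhainIkenmeyer2016, Thm. 6.1 (proof)] -/
theorem consWeight_succ (k : ℕ) (i j : Fin (m + 2)) (g : Fin k → Fin (m + 2)) :
    consWeight m (k + 1) i (Fin.cons j g) = X (j, i) * consWeight m k j g := by
  unfold consWeight
  rw [Fin.prod_univ_succ]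
  simp only [Fin.cons_succ, Fin.cons_zero, Fin.castSucc_zero', ← Fin.succ_castSucc]

/-- No walk leaves the target. [cite: HuttenhainIkenmeyer2016, Thm. 6.1 (proof)] -/
theorem hcABP_pow_inr_inl (k : ℕ) (u : Unit) (w : HCVert m) :
    (hcABP m ^ k) (Sum.inr u) (Sum.inl w) = 0 := by
  cases k with
  | zero =>
    rw [pow_zero]
    exact Matrix.one_apply_ne Sum.inr_ne_inl
  | succ k =>
    rw [pow_succ', Matrix.mul_apply]
    exact sum_eq_zero fun v _ => by rw [hcABP_inr, zero_mul]

/-- Summation over the vertices `(I, i)` as a double sum with an indicator.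
[cite: HuttenhainIkenmeyer2016, Thm. 6.1 (proof)] -/
theorem sum_HCVert {M : Type*} [AddCommMonoid M] (F : HCVert m → M) :
    ∑ w, F w = ∑ i : Fin (m + 2), ∑ I : Finset (Fin (m + 2)),
      if h : (i ∈ I ∧ (0 : Fin (m + 2)) ∉ I) ∨ (I, i) = (∅, 0) then F ⟨(I, i), h⟩ else 0 := by
  have h1 : ∑ w, F w = ∑ p ∈ univ.filter (fun p : Finset (Fin (m + 2)) × Fin (m + 2) =>
      (p.2 ∈ p.1 ∧ (0 : Fin (m + 2)) ∉ p.1) ∨ p = (∅, 0)),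
      (if h : (p.2 ∈ p.1 ∧ (0 : Fin (m + 2)) ∉ p.1) ∨ p = (∅, 0) then F ⟨p, h⟩ else 0) := by
    rw [Finset.sum_subtype (univ.filter _)
      (p := fun p : Finset (Fin (m + 2)) × Fin (m + 2) =>
        (p.2 ∈ p.1 ∧ (0 : Fin (m + 2)) ∉ p.1) ∨ p = (∅, 0)) (by simp)]
    refine Fintype.sum_congr _ _ fun w => ?_
    rw [dif_pos w.2]
  rw [h1, Finset.sum_filter, Fintype.sum_prod_type, Finset.sum_comm]
  refine sum_congr rfl fun i _ => sum_congr rfl fun I _ => ?_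
  split_ifs <;> rfl

/-- **Paths of the program** (Hüttenhain–Ikenmeyer 2016, §6.2, p0010:L29: "every cycle
`σ = (a_1, …, a_m, m+1)` corresponds to an `s`–`t`-path which has `v_{(I,i)}` as its `k`-th vertex
iff `I = {a_1, …, a_k}` and `i = a_k`"): the `(v_{(I,i)}, v_{(J,j)})` entry of `E^k` is the sum,
over the injective sequences `g : Fin k → Fin (m+2)` avoiding `I` with `J = I ∪ im g` and `j` the
last vertex of `(i, g)`, of the weights `∏_t X (c (t+1), c t)` of the paths `c = (i, g)`.
[cite: HuttenhainIkenmeyer2016, Thm. 6.1 (proof)] -/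
theorem hcABP_pow_inl_inl (k : ℕ) (w w' : HCVert m) :
    (hcABP m ^ k) (Sum.inl w) (Sum.inl w') = ∑ g : Fin k → Fin (m + 2),
      if Function.Injective g ∧ (∀ t, g t ∉ w.1.1) ∧ w'.1.1 = w.1.1 ∪ univ.image g ∧
          w'.1.2 = (Fin.cons w.1.2 g : Fin (k + 1) → Fin (m + 2)) (Fin.last k)
      then consWeight m k w.1.2 g else 0 := by
  induction k generalizing w with
  | zero =>
    rw [pow_zero, Matrix.one_apply]
    have key : ∀ g : Fin 0 → Fin (m + 2),
        (if Function.Injective g ∧ (∀ t, g t ∉ w.1.1) ∧ w'.1.1 = w.1.1 ∪ univ.image g ∧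
            w'.1.2 = (Fin.cons w.1.2 g : Fin 1 → Fin (m + 2)) (Fin.last 0)
          then consWeight m 0 w.1.2 g else 0) =
          if (Sum.inl w : HCVert m ⊕ Unit) = Sum.inl w' then 1 else 0 := by
      intro g
      have hcw : consWeight m 0 w.1.2 g = 1 := by simp [consWeight]
      have hiff : (Function.Injective g ∧ (∀ t, g t ∉ w.1.1) ∧ w'.1.1 = w.1.1 ∪ univ.image g ∧
            w'.1.2 = (Fin.cons w.1.2 g : Fin 1 → Fin (m + 2)) (Fin.last 0)) ↔
          (Sum.inl w : HCVert m ⊕ Unit) = Sum.inl w' := by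
        rw [Sum.inl.injEq, Subtype.ext_iff, Prod.ext_iff]
        simp only [Function.injective_of_subsingleton, IsEmpty.forall_iff, true_and,
          Finset.univ_eq_empty, Finset.image_empty, Finset.union_empty, Fin.last_zero,
          Fin.cons_zero]
        constructor
        · rintro ⟨h1, h2⟩
          exact ⟨h1.symm, h2.symm⟩
        · rintro ⟨h1, h2⟩
          exact ⟨h1.symm, h2.symm⟩
      rw [hcw]
      exact if_congr hiff rfl rfl
    simp_rw [key]
    rw [Fintype.sum_unique]
  | succ k ih =>
    have hcons_image : ∀ (j : Fin (m + 2)) (g : Fin k → Fin (m + 2)),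
        univ.image (Fin.cons j g : Fin (k + 1) → Fin (m + 2)) = insert j (univ.image g) := by
      intro j g
      ext a
      simp [Fin.exists_fin_succ, eq_comm]
    rw [pow_succ', Matrix.mul_apply, Fintype.sum_sum_type,
      show (∑ u : Unit, hcABP m (Sum.inl w) (Sum.inr u) * (hcABP m ^ k) (Sum.inr u) (Sum.inl w'))
        = 0 from Fintype.sum_eq_zero _ fun u => by rw [hcABP_pow_inr_inl, mul_zero], add_zero]
    simp only [hcABP_inl_inl, ih]
    rw [sum_HCVert]
    -- right-hand side: split `g' = Fin.cons i g`
    rw [← Fintype.sum_equiv (Fin.consEquiv fun _ => Fin (m + 2)) (fun p =>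
      if Function.Injective (Fin.cons p.1 p.2 : Fin (k + 1) → Fin (m + 2)) ∧
          (∀ t, (Fin.cons p.1 p.2 : Fin (k + 1) → Fin (m + 2)) t ∉ w.1.1) ∧
          w'.1.1 = w.1.1 ∪ univ.image (Fin.cons p.1 p.2 : Fin (k + 1) → Fin (m + 2)) ∧
          w'.1.2 = (Fin.cons w.1.2 (Fin.cons p.1 p.2 : Fin (k + 1) → Fin (m + 2)) :
            Fin (k + 2) → Fin (m + 2)) (Fin.last (k + 1))
      then consWeight m (k + 1) w.1.2 (Fin.cons p.1 p.2) else 0) _ (fun p => rfl),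
      Fintype.sum_prod_type]
    refine sum_congr rfl fun i _ => ?_
    -- collapse the sum over `I` to `I = insert i w.I`
    rw [Finset.sum_eq_single (insert i w.1.1)]
    rotate_left
    · intro I _ hI
      by_cases hP : (i ∈ I ∧ (0 : Fin (m + 2)) ∉ I) ∨ (I, i) = (∅, 0)
      · rw [dif_pos hP, if_neg, zero_mul]
        rintro ⟨-, hI'⟩
        exact hI hI'
      · rw [dif_neg hP]
    · intro h
      exact absurd (mem_univ _) h
    -- now compare the two sides for a fixed first vertex `i`
    have h0w : (0 : Fin (m + 2)) ∉ w.1.1 := HCVert.zero_not_mem m w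
    have h0w' : (0 : Fin (m + 2)) ∉ w'.1.1 := HCVert.zero_not_mem m w'
    simp only [Fin.cons_injective_iff, Fin.forall_fin_succ, Fin.cons_zero, Fin.cons_succ,
      hcons_image, Set.mem_range, not_exists, ← Fin.succ_last, consWeight_succ, and_true]
    by_cases hi : i ∈ w.1.1
    · -- no edge `(I, ·) → (insert i I, i)` when `i ∈ I`: both sides vanish
      have lhs0 : ∀ (P : Prop) [Decidable P] (S : MvPolynomial (Fin (m + 2) × Fin (m + 2)) ℤ),
          (if _h : P then (if i ∉ w.1.1 then X (i, w.1.2) else 0) * S else 0) = 0 := by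
        intro P _ S
        rw [if_neg (not_not_intro hi), zero_mul, dite_eq_ite, ite_self]
      rw [lhs0]
      symm
      exact sum_eq_zero fun g _ => if_neg fun h => h.2.1.1 hi
    by_cases hi0 : i = 0
    · -- the vertex `(insert 0 I, 0)` does not exist; on the right `0 ∈ w'.I` is impossible
      subst hi0
      have hP : ¬(((0 : Fin (m + 2)) ∈ insert (0 : Fin (m + 2)) w.1.1 ∧
          (0 : Fin (m + 2)) ∉ insert (0 : Fin (m + 2)) w.1.1) ∨
          (insert (0 : Fin (m + 2)) w.1.1, (0 : Fin (m + 2))) = (∅, 0)) := by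
        rintro (⟨-, h⟩ | h)
        · exact h (mem_insert_self _ _)
        · exact Finset.insert_ne_empty _ _ (Prod.ext_iff.mp h).1
      rw [dif_neg hP]
      symm
      refine sum_eq_zero fun g _ => if_neg ?_
      rintro ⟨-, -, hJ, -⟩
      exact h0w' (by rw [hJ]; simp)
    · have hP : ((i ∈ insert i w.1.1 ∧ (0 : Fin (m + 2)) ∉ insert i w.1.1) ∨
          (insert i w.1.1, i) = (∅, 0)) :=
        Or.inl ⟨mem_insert_self _ _, by simp [hi0, h0w, eq_comm]⟩
      rw [dif_pos hP, if_pos hi, mul_sum]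
      refine sum_congr rfl fun g _ => ?_
      have hiff : (Function.Injective g ∧ (∀ t, g t ∉ insert i w.1.1) ∧
            w'.1.1 = insert i w.1.1 ∪ univ.image g ∧
            w'.1.2 = (Fin.cons i g : Fin (k + 1) → Fin (m + 2)) (Fin.last k)) ↔
          (((∀ t, ¬g t = i) ∧ Function.Injective g) ∧ (i ∉ w.1.1 ∧ ∀ t, g t ∉ w.1.1) ∧
            w'.1.1 = w.1.1 ∪ insert i (univ.image g) ∧
            w'.1.2 = (Fin.cons i g : Fin (k + 1) → Fin (m + 2)) (Fin.last k)) := by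
        simp only [mem_insert, not_or, forall_and, union_insert, insert_union]
        tauto
      simp only [hiff]
      split_ifs <;> simp

end HuttenhainIkenmeyer

namespace HuttenhainIkenmeyer

variable (m : ℕ)

/-- Components of the source vertex. [cite: HuttenhainIkenmeyer2016, Thm. 6.1 (proof)] -/
theorem hcSource_val : (hcSource m).1 = (∅, 0) := rfl

/-- **Walks from the source to the target** have the target as `(k+1)`-st vertex only after
passing through a vertex `(univ ∖ {0}, j)`: the `(s, t)` entry of `E^{k+1}` is the sum over the
injective `g : Fin k → Fin (m+2)` enumerating `univ ∖ {0}` of the weight of the path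
`(0, g 0, …, g (k-1))` times the closing label `X (0, g (k-1))`.
[cite: HuttenhainIkenmeyer2016, Thm. 6.1 (proof)] -/
theorem hcABP_pow_source_target (k : ℕ) :
    (hcABP m ^ (k + 1)) (Sum.inl (hcSource m)) (Sum.inr ()) =
      ∑ g : Fin k → Fin (m + 2),
        if Function.Injective g ∧ univ.erase 0 = univ.image g then
          consWeight m k 0 g *
            X (0, (Fin.cons (0 : Fin (m + 2)) g : Fin (k + 1) → Fin (m + 2)) (Fin.last k))
        else 0 := by
  rw [pow_succ, Matrix.mul_apply, Fintype.sum_sum_type,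
    show (∑ u : Unit, (hcABP m ^ k) (Sum.inl (hcSource m)) (Sum.inr u) *
        hcABP m (Sum.inr u) (Sum.inr ())) = 0 from
      Fintype.sum_eq_zero _ fun u => by rw [hcABP_inr, mul_zero], add_zero]
  simp only [hcABP_pow_inl_inl, hcABP_inl_inr, hcSource_val, Finset.notMem_empty,
    not_false_eq_true, implies_true, true_and, Finset.empty_union]
  rw [sum_HCVert]
  have hne : (univ.erase (0 : Fin (m + 2))).Nonempty :=
    ⟨1, by simp⟩
  -- both sides as a double sum over the end vertex `i` and the sequence `g`
  rw [show (∑ g : Fin k → Fin (m + 2), if Function.Injective g ∧ univ.erase 0 = univ.image g then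
        consWeight m k 0 g * X (0, (Fin.cons (0 : Fin (m + 2)) g : Fin (k + 1) → Fin (m + 2))
          (Fin.last k)) else 0) =
      ∑ i : Fin (m + 2), ∑ g : Fin k → Fin (m + 2),
        if (Function.Injective g ∧ univ.erase 0 = univ.image g ∧
            i = (Fin.cons (0 : Fin (m + 2)) g : Fin (k + 1) → Fin (m + 2)) (Fin.last k))
        then consWeight m k 0 g * X (0, i) else 0 from ?_]
  swap
  · rw [Finset.sum_comm]
    refine sum_congr rfl fun g _ => ?_
    rw [Finset.sum_eq_single ((Fin.cons (0 : Fin (m + 2)) g : Fin (k + 1) → Fin (m + 2))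
      (Fin.last k))]
    · by_cases hc : Function.Injective g ∧ univ.erase 0 = univ.image g
      · rw [if_pos hc, if_pos ⟨hc.1, hc.2, rfl⟩]
      · rw [if_neg hc, if_neg fun h => hc ⟨h.1, h.2.1⟩]
    · intro i _ hi
      exact if_neg fun h => hi h.2.2
    · intro h
      exact absurd (mem_univ _) h
  refine sum_congr rfl fun i _ => ?_
  rw [Finset.sum_eq_single (univ.erase (0 : Fin (m + 2)))]
  rotate_left
  · intro I _ hI
    by_cases hP : (i ∈ I ∧ (0 : Fin (m + 2)) ∉ I) ∨ (I, i) = (∅, 0)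
    · rw [dif_pos hP, if_neg hI, mul_zero]
    · rw [dif_neg hP]
  · intro h
    exact absurd (mem_univ _) h
  by_cases hi0 : i = 0
  · -- no vertex `(univ ∖ 0, 0)`; on the right the last vertex of the path is not `0`
    subst hi0
    have hP : ¬(((0 : Fin (m + 2)) ∈ univ.erase (0 : Fin (m + 2)) ∧
        (0 : Fin (m + 2)) ∉ univ.erase (0 : Fin (m + 2))) ∨
        (univ.erase (0 : Fin (m + 2)), (0 : Fin (m + 2))) = (∅, 0)) := by
      rintro (⟨h, -⟩ | h)
      · simp at h
      · exact hne.ne_empty (Prod.ext_iff.mp h).1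
    rw [dif_neg hP]
    symm
    refine sum_eq_zero fun g _ => if_neg ?_
    rintro ⟨-, himg, hlast⟩
    cases k with
    | zero =>
      rw [show (univ : Finset (Fin 0)) = ∅ from Finset.univ_eq_empty, Finset.image_empty] at himg
      exact hne.ne_empty himg
    | succ k =>
      rw [← Fin.succ_last, Fin.cons_succ] at hlast
      have hmem : g (Fin.last k) ∈ univ.erase (0 : Fin (m + 2)) := by
        rw [himg]
        exact mem_image_of_mem _ (mem_univ _)
      rw [← hlast] at hmem
      simp at hmem
  · have hP : ((i ∈ univ.erase (0 : Fin (m + 2)) ∧ (0 : Fin (m + 2)) ∉ univ.erase (0 : Fin (m + 2)))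
        ∨ (univ.erase (0 : Fin (m + 2)), i) = (∅, 0)) := Or.inl ⟨by simp [hi0], by simp⟩
    rw [dif_pos hP, if_pos rfl, Finset.sum_mul]
    refine sum_congr rfl fun g _ => ?_
    by_cases hc : Function.Injective g ∧ univ.erase 0 = univ.image g ∧
        i = (Fin.cons (0 : Fin (m + 2)) g : Fin (k + 1) → Fin (m + 2)) (Fin.last k)
    · rw [if_pos hc, if_pos ⟨hc.1, hc.2.1, hc.2.2⟩]
    · rw [if_neg hc, if_neg fun h => hc ⟨h.1, h.2.1, h.2.2⟩, zero_mul]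

/-- All `s`–`t`-paths of the program have length `m + 2`: the other powers vanish at `(s, t)`.
[cite: HuttenhainIkenmeyer2016, Thm. 6.1 (proof)] -/
theorem hcABP_pow_source_target_eq_zero {k : ℕ} (hk : k ≠ m + 1) :
    (hcABP m ^ (k + 1)) (Sum.inl (hcSource m)) (Sum.inr ()) = 0 := by
  rw [hcABP_pow_source_target]
  refine sum_eq_zero fun g _ => if_neg ?_
  rintro ⟨hg, himg⟩
  have hcard := congrArg Finset.card himg
  rw [card_erase_of_mem (mem_univ _), card_univ, Fintype.card_fin,
    card_image_of_injective _ hg, card_univ, Fintype.card_fin] at hcard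
  omega

/-- `finRotate` moves `castSucc t` to `succ t`. [folklore] -/
private theorem finRotate_castSucc_eq (t : Fin (m + 1)) : finRotate (m + 2) t.castSucc = t.succ := by
  ext
  rw [finRotate_apply, Fin.val_add_one_of_lt (Fin.castSucc_lt_last t), Fin.val_castSucc,
    Fin.val_succ]

/-- **The `s`–`t`-paths of length `m + 2` are the Hamiltonian cycles** (Hüttenhain–Ikenmeyer
2016, §6.2, p0011:L1: "all `s`–`t`-paths in `Γ` have the same lengths and correspond uniquely to
cycles in `𝔖_{m+1}`"): `(E^{m+2}) s t = HC_{m+2}` in the tree's form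
`hamiltonianCycleSum_eq_sum_orderings` (orderings `σ` with `σ 0 = 0`).
[cite: HuttenhainIkenmeyer2016, Thm. 6.1 (proof)] -/
theorem hcABP_pow_source_target_eq_hcPoly :
    (hcABP m ^ (m + 2)) (Sum.inl (hcSource m)) (Sum.inr ()) = hcPoly (Fin (m + 2)) ℤ := by
  rw [hcABP_pow_source_target, hcPoly, hamiltonianCycleSum_eq_sum_orderings, Finset.sum_filter]
  -- the weight of an ordering as a function `f : Fin (m+2) → Fin (m+2)`
  set Wt : (Fin (m + 2) → Fin (m + 2)) → MvPolynomial (Fin (m + 2) × Fin (m + 2)) ℤ :=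
    fun f => ∏ t, X (f (finRotate (m + 2) t), f t) with hWt
  have hrhs : (∑ σ : Equiv.Perm (Fin (m + 2)), if σ 0 = 0 then
      ∏ t, Matrix.mvPolynomialX (Fin (m + 2)) (Fin (m + 2)) ℤ (σ (finRotate (m + 2) t)) (σ t)
      else 0) = ∑ σ : Equiv.Perm (Fin (m + 2)), (fun f : Fin (m + 2) → Fin (m + 2) =>
        if f 0 = 0 then Wt f else 0) σ := by
    refine sum_congr rfl fun σ _ => ?_
    simp only [hWt, Matrix.mvPolynomialX_apply]
  rw [hrhs]
  refine Eq.trans ?_ (Grenet.sum_ite_injective fun f : Fin (m + 2) → Fin (m + 2) =>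
    if f 0 = 0 then Wt f else 0)
  rw [← Fintype.sum_equiv (Fin.consEquiv fun _ => Fin (m + 2))
    (fun p => if Function.Injective (Fin.cons p.1 p.2 : Fin (m + 2) → Fin (m + 2)) then
      (if (Fin.cons p.1 p.2 : Fin (m + 2) → Fin (m + 2)) 0 = 0 then Wt (Fin.cons p.1 p.2) else 0)
      else 0) _ (fun p => rfl), Fintype.sum_prod_type, Fintype.sum_eq_single (0 : Fin (m + 2))]
  · refine sum_congr rfl fun g _ => ?_
    simp only [Fin.cons_zero, if_true, Fin.cons_injective_iff, Set.mem_range, not_exists]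
    have hiff : (Function.Injective g ∧ univ.erase 0 = univ.image g) ↔
        ((∀ t, ¬g t = 0) ∧ Function.Injective g) := by
      constructor
      · rintro ⟨hg, himg⟩
        refine ⟨fun t ht => ?_, hg⟩
        have hmem : g t ∈ univ.erase (0 : Fin (m + 2)) := by
          rw [himg]
          exact mem_image_of_mem _ (mem_univ _)
        rw [ht] at hmem
        simp at hmem
      · rintro ⟨h0, hg⟩
        refine ⟨hg, (Finset.eq_of_subset_of_card_le (fun x hx => ?_) ?_).symm⟩
        · obtain ⟨t, -, rfl⟩ := mem_image.mp hx
          exact mem_erase.mpr ⟨h0 t, mem_univ _⟩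
        · rw [card_erase_of_mem (mem_univ _), card_univ, Fintype.card_fin,
            card_image_of_injective _ hg, card_univ, Fintype.card_fin]
          omega
    rw [if_congr hiff rfl rfl]
    split_ifs with hc
    · rw [hWt]
      show _ = ∏ t, X ((Fin.cons 0 g : Fin (m + 2) → Fin (m + 2)) (finRotate (m + 2) t),
        (Fin.cons 0 g : Fin (m + 2) → Fin (m + 2)) t)
      rw [Fin.prod_univ_castSucc, finRotate_last, Fin.cons_zero, ← Fin.succ_last,
        Fin.cons_succ, consWeight]
      congr 1
      refine prod_congr rfl fun t _ => ?_
      rw [finRotate_castSucc_eq]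
    · rfl
  · intro x hx
    refine sum_eq_zero fun g _ => ?_
    rw [Fin.cons_zero, if_neg hx, ite_self]

/-- At least `m + 2` internal vertices: `s` and the `({i}, i)`, `i ≠ 0`.
[cite: HuttenhainIkenmeyer2016, Thm. 6.1 (proof)] -/
theorem card_HCVert_ge : m + 2 ≤ Fintype.card (HCVert m) := by
  let f : Fin (m + 2) → HCVert m := fun i =>
    if h : i = 0 then hcSource m
    else ⟨({i}, i), Or.inl ⟨mem_singleton_self i, by simpa [mem_singleton, eq_comm] using h⟩⟩
  have hf : Function.Injective f := by
    intro i j hij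
    by_cases hi : i = 0 <;> by_cases hj : j = 0
    · rw [hi, hj]
    · simp only [f, dif_pos hi, dif_neg hj, hcSource, Subtype.mk.injEq, Prod.mk.injEq] at hij
      exact absurd hij.1 (Finset.singleton_ne_empty j).symm
    · simp only [f, dif_neg hi, dif_pos hj, hcSource, Subtype.mk.injEq, Prod.mk.injEq] at hij
      exact absurd hij.1 (Finset.singleton_ne_empty i)
    · simp only [f, dif_neg hi, dif_neg hj, Subtype.mk.injEq, Prod.mk.injEq] at hij
      exact hij.2
  simpa using Fintype.card_le_of_injective f hf

/-- **Vertex count** (Hüttenhain–Ikenmeyer 2016, §6.2, p0010:L29: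
`1 + ∑_{i=1}^{m} binom(m,i) · i = m · 2^{m−1} + 1` internal vertices): here, with `m + 1` in the
role of the source's `m`, at most `(m+1) 2^m + 1` vertices `(I, i)` including `s` (injection
`(I, i) ↦ (i, I ∖ {i})`). [cite: HuttenhainIkenmeyer2016, Thm. 6.1 (proof)] -/
theorem card_HCVert_le : Fintype.card (HCVert m) ≤ (m + 1) * 2 ^ m + 1 := by
  classical
  rw [Fintype.card_subtype]
  set P1 : Finset (Fin (m + 2)) × Fin (m + 2) → Prop := fun p =>
    p.2 ∈ p.1 ∧ (0 : Fin (m + 2)) ∉ p.1 with hP1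
  have hsub : (univ.filter fun p : Finset (Fin (m + 2)) × Fin (m + 2) =>
      (p.2 ∈ p.1 ∧ (0 : Fin (m + 2)) ∉ p.1) ∨ p = (∅, 0)) ⊆ univ.filter P1 ∪ {(∅, 0)} := by
    intro p hp
    rw [mem_filter] at hp
    rcases hp.2 with h | h
    · exact mem_union_left _ (mem_filter.mpr ⟨mem_univ _, h⟩)
    · exact mem_union_right _ (mem_singleton.mpr h)
  refine (card_le_card hsub).trans ((card_union_le _ _).trans ?_)
  rw [card_singleton, Nat.add_le_add_iff_right]
  -- inject into the pairs `(i, J)`, `i ≠ 0`, `J ⊆ univ ∖ {0, i}`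
  let T : Finset ((_ : Fin (m + 2)) × Finset (Fin (m + 2))) :=
    (univ.erase (0 : Fin (m + 2))).sigma fun i => ((univ.erase (0 : Fin (m + 2))).erase i).powerset
  have hT : T.card = (m + 1) * 2 ^ m := by
    rw [Finset.card_sigma, Finset.sum_congr rfl fun i hi => by
      rw [Finset.card_powerset, card_erase_of_mem hi, card_erase_of_mem (mem_univ _), card_univ,
        Fintype.card_fin], Finset.sum_const, card_erase_of_mem (mem_univ _), card_univ,
      Fintype.card_fin, smul_eq_mul]
    rfl
  rw [← hT]
  refine Finset.card_le_card_of_injOn (fun p => ⟨p.2, p.1.erase p.2⟩) (fun p hp => ?_)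
    (fun p hp q hq hpq => ?_)
  · rw [mem_coe, mem_filter] at hp
    obtain ⟨hi, h0⟩ := hp.2
    rw [mem_coe, Finset.mem_sigma, mem_erase, Finset.mem_powerset]
    refine ⟨⟨fun h => h0 (h ▸ hi), mem_univ _⟩, fun x hx => ?_⟩
    rw [mem_erase] at hx ⊢
    exact ⟨hx.1, mem_erase.mpr ⟨fun h => h0 (h ▸ hx.2), mem_univ _⟩⟩
  · rw [mem_coe, mem_filter] at hp hq
    simp only [Sigma.mk.inj_iff, heq_eq_eq] at hpq
    obtain ⟨h2, h1⟩ := hpq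
    refine Prod.ext ?_ h2
    rw [← insert_erase hp.2.1, ← insert_erase hq.2.1, h1, h2]

/-- The path value of the program is `±HC_{m+2}` (all paths have length `m + 2`).
[cite: HuttenhainIkenmeyer2016, Thm. 6.1 (proof)] -/
theorem pathValue_hcABP :
    pathValue (hcABP m) (Sum.inl (hcSource m)) (Sum.inr ()) =
      (-1) ^ (m + 1) * hcPoly (Fin (m + 2)) ℤ := by
  rw [pathValue, Finset.sum_eq_single (m + 1)]
  · rw [hcABP_pow_source_target_eq_hcPoly]
  · intro k _ hk
    rw [hcABP_pow_source_target_eq_zero m hk, mul_zero]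
  · intro h
    exfalso
    refine h (mem_range.mpr ?_)
    have := card_HCVert_ge m
    rw [Fintype.card_sum, Fintype.card_unit]
    omega

end HuttenhainIkenmeyer

/-- **Theorem 6.1, discharged** (Hüttenhain–Ikenmeyer 2016, §6, p0010:L5): for all `m`,
`HC_{m+1}` is the determinant of a binary variable matrix of size `m · 2^{m−1} + 1`. For
`m + 1 ≥ 2`: Lemma 6.2 applied to the program `HuttenhainIkenmeyer.hcABP` (§6.2), whose path value
is `±HC` (`pathValue_hcABP`) and which has at most `m 2^{m−1} + 2` vertices (`card_HCVert_le`),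
then padding (`HasBinaryDetRepr.mono`); for `m = 0` the tree's `HC_1 = 0 = det (0)`.
[cite: HuttenhainIkenmeyer2016, Thm. 6.1] -/
theorem huttenhainIkenmeyer2016_thm14_holds : huttenhainIkenmeyer2016_thm14 := by
  intro m
  rcases m with _ | m
  · refine ⟨Matrix.of fun _ _ => 0, fun _ _ => Or.inl rfl, ?_⟩
    rw [hcPoly_fin_eq_zero_of_le_one ℤ le_rfl]
    simp [Matrix.det_unique]
  · show HasBinaryDetRepr (hcPoly (Fin (m + 2)) ℤ) ((m + 1) * 2 ^ m + 1)
    have hge := HuttenhainIkenmeyer.card_HCVert_ge m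
    have hle := HuttenhainIkenmeyer.card_HCVert_le m
    have h3 : 3 ≤ Fintype.card (HuttenhainIkenmeyer.HCVert m ⊕ Unit) := by
      rw [Fintype.card_sum, Fintype.card_unit]
      omega
    have key := huttenhainIkenmeyer2016_lemma15 (HuttenhainIkenmeyer.isBinaryABP_hcABP m) h3
      (f := hcPoly (Fin (m + 2)) ℤ) ?_
    · refine key.mono ?_
      rw [Fintype.card_sum, Fintype.card_unit]
      omega
    · rw [HuttenhainIkenmeyer.pathValue_hcABP]
      rcases neg_one_pow_eq_or (MvPolynomial (Fin (m + 2) × Fin (m + 2)) ℤ) (m + 1) with h | h <;>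
        simp [h]

end HC

/-! ## §2, Proposition 2.2: the cost of computing integers (discharge)

Hüttenhain–Ikenmeyer 2016, Prop. 2.2 (p0004:L20–L30): a binary ABP with `O(log |c|)` vertices, all
labels `1`, and path value `c`. The printed proof subdivides an addition chain obtained by repeated
squaring; we use the binary-expansion ladder directly (levels `u_0, …, u_k`, `k = ⌊log₂ |c|⌋`, two
parallel length-2 routes `u_i → a_i → u_{i+1}`, `u_i → b_i → u_{i+1}` so that `u_0 ⇝ u_i` has
`2^i` paths of even length, and an exit from `u_i` towards `t` for every binary digit `1` of `|c|`:
directly (odd total length, weight `+1`) for `c > 0`, through an extra vertex `e_i` (even total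
length, weight `−1`) for `c < 0`), `4k + 3 ≤ 4 (⌊log₂ |c|⌋ + 1)` vertices. Path values are
computed by the signed Bellman recursion `Q v = E v t − ∑_w E v w · Q w`
(`HuttenhainIkenmeyer.pathValue_eq_sub_sum`), not by counting paths. -/

section Constants

namespace HuttenhainIkenmeyer

variable {V : Type*} [Fintype V] [DecidableEq V] {R : Type*} [CommRing R]
variable {E : Matrix V V R} {rk : V → ℕ}

/-- In a ranked digraph no walk of positive length is closed: `pathValue E t t = 0`. [folklore] -/
private theorem pathValue_self (hrk : ∀ u v, E u v ≠ 0 → rk u < rk v) (t : V) :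
    pathValue E t t = 0 := by
  refine sum_eq_zero fun ℓ _ => ?_
  have h : (E ^ (ℓ + 1)) t t = 0 := by
    by_contra h
    obtain ⟨-, hle⟩ := rank_le_of_pow_apply_ne_zero hrk _ t t h
    have : (univ.filter fun x => rk t ≤ rk x ∧ rk x < rk t).card = 0 :=
      Finset.card_eq_zero.mpr (Finset.filter_eq_empty_iff.mpr fun x _ h => by omega)
    omega
  rw [h, mul_zero]

/-- **Signed Bellman recursion** for path values in a ranked (acyclic) digraph:
`pathValue E v t = E v t − ∑_w E v w · pathValue E w t` (a path is an edge, or an edge followed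
by a shorter path, whose sign flips). [folklore] -/
private theorem pathValue_eq_sub_sum (hrk : ∀ u v, E u v ≠ 0 → rk u < rk v) (v t : V) :
    pathValue E v t = E v t - ∑ w, E v w * pathValue E w t := by
  obtain ⟨k, hk⟩ : ∃ k, Fintype.card V = k + 1 :=
    Nat.exists_eq_add_one_of_ne_zero (Fintype.card_pos_iff.mpr ⟨v⟩).ne'
  have h0 : E ^ (k + 1) = 0 := hk ▸ pow_card_eq_zero hrk
  have hw : ∀ w, pathValue E w t = ∑ ℓ ∈ range k, (-1 : R) ^ ℓ * (E ^ (ℓ + 1)) w t := by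
    intro w
    rw [pathValue, hk, Finset.sum_range_succ, h0, Matrix.zero_apply, mul_zero, add_zero]
  have hS : ∑ w, E v w * pathValue E w t = ∑ ℓ ∈ range k, (-1 : R) ^ ℓ * (E ^ (ℓ + 1 + 1)) v t := by
    simp only [hw, Finset.mul_sum]
    rw [Finset.sum_comm]
    refine sum_congr rfl fun ℓ _ => ?_
    rw [pow_succ' E (ℓ + 1), Matrix.mul_apply, Finset.mul_sum]
    refine sum_congr rfl fun w _ => ?_
    ring
  rw [hS, pathValue, hk, Finset.sum_range_succ', pow_zero, one_mul, zero_add, pow_one,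
    eq_sub_iff_add_eq, add_right_comm, ← Finset.sum_add_distrib, Finset.sum_eq_zero, zero_add]
  intro ℓ _
  ring

/-! ### The ladder gadget -/

/-- Vertices of the ladder for a `k+1`-digit number: levels `u_i` (`Fin (k+1)`), doubling
vertices `a_j, b_j` (`Fin k ⊕ Fin k`), exit vertices `e_i` (`Fin (k+1)`) and the target `t`.
[cite: HuttenhainIkenmeyer2016, Prop. 2.2 (proof)] -/
abbrev LadderV (k : ℕ) : Type := Fin (k + 1) ⊕ ((Fin k ⊕ Fin k) ⊕ (Fin (k + 1) ⊕ Unit))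

section Ladder

variable (k N : ℕ) (neg : Bool)

/-- The adjacency relation of the ladder (all labels `1`): `u_i → a_i, b_i → u_{i+1}`; exits
`u_i → t` (if `neg = false`) resp. `u_i → e_i` (if `neg = true`) whenever the binary digit
`⌊N / 2^i⌋ mod 2` is `1`; `e_i → t`. [cite: HuttenhainIkenmeyer2016, Prop. 2.2 (proof)] -/
def ladderAdj : LadderV k → LadderV k → Bool
  | Sum.inl i, Sum.inr (Sum.inl (Sum.inl j)) => decide ((i : ℕ) = j)
  | Sum.inl i, Sum.inr (Sum.inl (Sum.inr j)) => decide ((i : ℕ) = j)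
  | Sum.inr (Sum.inl (Sum.inl j)), Sum.inl i => decide ((i : ℕ) = j + 1)
  | Sum.inr (Sum.inl (Sum.inr j)), Sum.inl i => decide ((i : ℕ) = j + 1)
  | Sum.inl i, Sum.inr (Sum.inr (Sum.inl i')) => neg && decide (i = i') && decide (N / 2 ^ (i : ℕ) % 2 = 1)
  | Sum.inl i, Sum.inr (Sum.inr (Sum.inr _)) => !neg && decide (N / 2 ^ (i : ℕ) % 2 = 1)
  | Sum.inr (Sum.inr (Sum.inl _)), Sum.inr (Sum.inr (Sum.inr _)) => true
  | _, _ => false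

variable {σ : Type*}

/-- The ladder as a `0/1` adjacency matrix. [cite: HuttenhainIkenmeyer2016, Prop. 2.2 (proof)] -/
def ladder (σ : Type*) : Matrix (LadderV k) (LadderV k) (MvPolynomial σ ℤ) :=
  Matrix.of fun x y => if ladderAdj k N neg x y then 1 else 0

/-- Entries of the ladder matrix. [cite: HuttenhainIkenmeyer2016, Prop. 2.2 (proof)] -/
theorem ladder_apply (x y : LadderV k) :
    ladder k N neg σ x y = if ladderAdj k N neg x y then 1 else 0 := rfl

/-- The ranking of the ladder: `u_i ↦ 3i`, `a_j, b_j ↦ 3j+1`, `e_i ↦ 3k+4`, `t ↦ 3k+5`.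
[cite: HuttenhainIkenmeyer2016, Prop. 2.2 (proof)] -/
def ladderRank : LadderV k → ℕ
  | Sum.inl i => 3 * i
  | Sum.inr (Sum.inl (Sum.inl j)) => 3 * j + 1
  | Sum.inr (Sum.inl (Sum.inr j)) => 3 * j + 1
  | Sum.inr (Sum.inr (Sum.inl _)) => 3 * k + 4
  | Sum.inr (Sum.inr (Sum.inr _)) => 3 * k + 5

/-- The ranking increases along the edges of the ladder. [cite: HuttenhainIkenmeyer2016, Prop. 2.2 (proof)] -/
theorem ladderRank_lt {x y : LadderV k} (h : ladderAdj k N neg x y = true) :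
    ladderRank k x < ladderRank k y := by
  rcases x with i | ((j | j) | (i | u)) <;> rcases y with i' | ((j' | j') | (i'' | u')) <;>
    simp [ladderAdj, ladderRank] at h ⊢ <;> omega

/-- The ladder is a binary ABP from `u_0` to `t`. [cite: HuttenhainIkenmeyer2016, Prop. 2.2 (proof)] -/
theorem isBinaryABP_ladder :
    IsBinaryABP (ladder k N neg σ) (Sum.inl 0) (Sum.inr (Sum.inr (Sum.inr ()))) where
  binary := fun x y => by
    rw [ladder_apply]
    split_ifs
    · exact Or.inr (Or.inl rfl)
    · exact Or.inl rfl
  acyclic := ⟨ladderRank k, fun x y h => by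
    rw [ladder_apply] at h
    by_cases hxy : ladderAdj k N neg x y = true
    · exact ladderRank_lt k N neg hxy
    · exact absurd (if_neg hxy) h⟩
  source_ne_target := Sum.inl_ne_inr
  eq_zero_to_source := fun x => by
    rw [ladder_apply, if_neg]
    rcases x with i | ((j | j) | (i | u)) <;> simp [ladderAdj]
  eq_zero_from_target := fun y => by
    rw [ladder_apply, if_neg]
    rcases y with i | ((j | j) | (i | u)) <;> simp [ladderAdj]

/-- All labels of the ladder are `0` or `1`. [cite: HuttenhainIkenmeyer2016, Prop. 2.2 (proof)] -/
theorem ladder_apply_eq_zero_or_one (x y : LadderV k) :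
    ladder k N neg σ x y = 0 ∨ ladder k N neg σ x y = 1 := by
  rw [ladder_apply]
  split_ifs
  · exact Or.inr rfl
  · exact Or.inl rfl

end Ladder

end HuttenhainIkenmeyer

namespace HuttenhainIkenmeyer

section LadderValues

variable (k N : ℕ) (neg : Bool) (σ : Type*)

/-- The target of the ladder. [cite: HuttenhainIkenmeyer2016, Prop. 2.2 (proof)] -/
abbrev ladderT : LadderV k := Sum.inr (Sum.inr (Sum.inr ()))

/-- Path values of the ladder towards its target. [cite: HuttenhainIkenmeyer2016, Prop. 2.2 (proof)] -/
abbrev ladderQ (x : LadderV k) : MvPolynomial σ ℤ := pathValue (ladder k N neg σ) x (ladderT k)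

/-- The ranking hypothesis of the ladder, in the form used by the path-value lemmas.
[cite: HuttenhainIkenmeyer2016, Prop. 2.2 (proof)] -/
theorem ladder_ranked : ∀ x y, ladder k N neg σ x y ≠ 0 → ladderRank k x < ladderRank k y := by
  intro x y h
  rw [ladder_apply] at h
  by_cases hxy : ladderAdj k N neg x y = true
  · exact ladderRank_lt k N neg hxy
  · exact absurd (if_neg hxy) h

/-- `Q t = 0`. [cite: HuttenhainIkenmeyer2016, Prop. 2.2 (proof)] -/
theorem ladderQ_target : ladderQ k N neg σ (ladderT k) = 0 :=
  pathValue_self (ladder_ranked k N neg σ) _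

/-- `Q e_i = 1` (the single edge `e_i → t`). [cite: HuttenhainIkenmeyer2016, Prop. 2.2 (proof)] -/
theorem ladderQ_exit (i : Fin (k + 1)) : ladderQ k N neg σ (Sum.inr (Sum.inr (Sum.inl i))) = 1 := by
  rw [ladderQ, pathValue_eq_sub_sum (ladder_ranked k N neg σ), Finset.sum_eq_zero, sub_zero,
    ladder_apply]
  · simp [ladderAdj]
  · intro w _
    rcases w with i' | ((j | j) | (i' | u))
    · simp [ladder_apply, ladderAdj]
    · simp [ladder_apply, ladderAdj]
    · simp [ladder_apply, ladderAdj]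
    · simp [ladder_apply, ladderAdj]
    · have h0 := ladderQ_target k N neg σ
      simp only [ladderQ, ladderT] at h0
      rw [h0, mul_zero]

/-- `Q a_j = − Q u_{j+1}` and `Q b_j = − Q u_{j+1}` (the single edges `a_j, b_j → u_{j+1}`).
[cite: HuttenhainIkenmeyer2016, Prop. 2.2 (proof)] -/
theorem ladderQ_mid (j : Fin k) (lr : Bool) :
    ladderQ k N neg σ (Sum.inr (Sum.inl (cond lr (Sum.inl j) (Sum.inr j)))) =
      -ladderQ k N neg σ (Sum.inl j.succ) := by
  rw [ladderQ, pathValue_eq_sub_sum (ladder_ranked k N neg σ), Fintype.sum_sum_type,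
    Fintype.sum_eq_single (j.succ : Fin (k + 1)), Finset.sum_eq_zero]
  · rcases lr <;> simp [ladder_apply, ladderAdj, Fin.val_succ]
  · intro w _
    rcases lr <;> rcases w with (j' | j') | (i' | u) <;> simp [ladder_apply, ladderAdj]
  · intro i' hi'
    have : (i' : ℕ) ≠ j + 1 := fun h => hi' (Fin.ext (by rw [h, Fin.val_succ]))
    rcases lr <;> simp [ladder_apply, ladderAdj, this]

/-- The sign realised by the ladder. [cite: HuttenhainIkenmeyer2016, Prop. 2.2 (proof)] -/
def ladderSign : ℤ := if neg then -1 else 1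

/-- **Values at the levels**: `Q u_i = ± ⌊N / 2^i⌋` (binary expansion read from level `i` up),
by descending induction on `i`, provided `2^k ≤ N < 2^{k+1}`.
[cite: HuttenhainIkenmeyer2016, Prop. 2.2 (proof)] -/
theorem ladderQ_level (hlo : 2 ^ k ≤ N) (hhi : N < 2 ^ (k + 1)) :
    ∀ d (i : Fin (k + 1)), (i : ℕ) + d = k →
      ladderQ k N neg σ (Sum.inl i) = C (ladderSign neg * ((N / 2 ^ (i : ℕ) : ℕ) : ℤ)) := by
  have ht := ladderQ_target k N neg σ
  have he := ladderQ_exit k N neg σ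
  simp only [ladderQ, ladderT] at ht he
  -- the recursion at a level vertex
  have hrec : ∀ i : Fin (k + 1), ladderQ k N neg σ (Sum.inl i) =
      (if (!neg && decide (N / 2 ^ (i : ℕ) % 2 = 1)) = true then 1 else 0) -
        ((∑ j : Fin k, if (i : ℕ) = j then ladderQ k N neg σ (Sum.inr (Sum.inl (Sum.inl j))) else 0) +
         (∑ j : Fin k, if (i : ℕ) = j then ladderQ k N neg σ (Sum.inr (Sum.inl (Sum.inr j))) else 0) +
         (if (neg && decide (N / 2 ^ (i : ℕ) % 2 = 1)) = true then 1 else 0)) := by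
    intro i
    have piece_u : ∑ i' : Fin (k + 1), ladder k N neg σ (Sum.inl i) (Sum.inl i') *
        pathValue (ladder k N neg σ) (Sum.inl i') (ladderT k) = 0 :=
      sum_eq_zero fun i' _ => by simp [ladder_apply, ladderAdj]
    have piece_ab : ∀ lr : Bool, ∑ j : Fin k,
        ladder k N neg σ (Sum.inl i) (Sum.inr (Sum.inl (cond lr (Sum.inl j) (Sum.inr j)))) *
          pathValue (ladder k N neg σ) (Sum.inr (Sum.inl (cond lr (Sum.inl j) (Sum.inr j))))
            (ladderT k) =
        ∑ j : Fin k, if (i : ℕ) = j then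
          ladderQ k N neg σ (Sum.inr (Sum.inl (cond lr (Sum.inl j) (Sum.inr j)))) else 0 := by
      intro lr
      refine sum_congr rfl fun j _ => ?_
      rcases lr <;> simp [ladder_apply, ladderAdj, ladderQ, ladderT]
    have piece_e : ∑ i' : Fin (k + 1), ladder k N neg σ (Sum.inl i) (Sum.inr (Sum.inr (Sum.inl i'))) *
        pathValue (ladder k N neg σ) (Sum.inr (Sum.inr (Sum.inl i'))) (ladderT k) =
        if (neg && decide (N / 2 ^ (i : ℕ) % 2 = 1)) = true then 1 else 0 := by
      rw [Fintype.sum_eq_single i]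
      · rw [he, mul_one, ladder_apply]
        simp [ladderAdj]
      · intro i' hi'
        rw [ladder_apply, if_neg, zero_mul]
        simp only [ladderAdj, Bool.and_eq_true, decide_eq_true_eq]
        rintro ⟨⟨-, h⟩, -⟩
        exact hi' h.symm
    have piece_t : ∀ u : Unit, ladder k N neg σ (Sum.inl i) (Sum.inr (Sum.inr (Sum.inr u))) *
        pathValue (ladder k N neg σ) (Sum.inr (Sum.inr (Sum.inr u))) (ladderT k) = 0 := by
      intro u
      rw [show Sum.inr (Sum.inr (Sum.inr u)) = ladderT k from rfl, ht, mul_zero]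
    have ha := piece_ab true
    have hb := piece_ab false
    simp only [cond_true, cond_false] at ha hb
    rw [ladderQ, pathValue_eq_sub_sum (ladder_ranked k N neg σ), Fintype.sum_sum_type,
      Fintype.sum_sum_type, Fintype.sum_sum_type, Fintype.sum_sum_type, piece_u, ha, hb, piece_e,
      Fintype.sum_eq_zero _ piece_t, zero_add, add_zero, ladder_apply]
    simp [ladderAdj]
  -- the top digit is `1`
  have hdiv : N / 2 ^ k = 1 := by
    have h1 : 1 ≤ N / 2 ^ k := (Nat.one_le_div_iff (Nat.two_pow_pos k)).mpr hlo
    have h2 : N / 2 ^ k < 2 := Nat.div_lt_of_lt_mul (by rwa [pow_succ] at hhi)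
    omega
  intro d
  induction d with
  | zero =>
    intro i hi
    rw [add_zero] at hi
    rw [hrec]
    have hnone : ∀ (lr : Bool), (∑ j : Fin k, if (i : ℕ) = j then
        ladderQ k N neg σ (Sum.inr (Sum.inl (cond lr (Sum.inl j) (Sum.inr j)))) else 0) = 0 :=
      fun lr => sum_eq_zero fun j _ => if_neg (by rw [hi]; exact (ne_of_gt j.isLt))
    have ha := hnone true
    have hb := hnone false
    simp only [cond_true, cond_false] at ha hb
    rw [ha, hb, zero_add, zero_add, hi, hdiv, ladderSign]
    rcases neg <;> simp
  | succ d ih =>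
    intro i hi
    have hik : (i : ℕ) < k := by omega
    have hIH := ih ⟨(i : ℕ) + 1, by omega⟩ (by simp only; omega)
    rw [hrec]
    have hsum : ∀ (lr : Bool), (∑ j : Fin k, if (i : ℕ) = j then
        ladderQ k N neg σ (Sum.inr (Sum.inl (cond lr (Sum.inl j) (Sum.inr j)))) else 0) =
        -ladderQ k N neg σ (Sum.inl ⟨(i : ℕ) + 1, by omega⟩) := by
      intro lr
      rw [Fintype.sum_eq_single (⟨i, hik⟩ : Fin k) (fun j hj => if_neg fun h =>
        hj (Fin.ext h.symm)), if_pos rfl, ladderQ_mid]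
      rfl
    have ha := hsum true
    have hb := hsum false
    simp only [cond_true, cond_false] at ha hb
    rw [ha, hb, hIH]
    -- arithmetic: digit + 2 · ⌊N/2^{i+1}⌋ = ⌊N/2^i⌋
    have hdig : N / 2 ^ (i : ℕ) = 2 * (N / 2 ^ ((i : ℕ) + 1)) + N / 2 ^ (i : ℕ) % 2 := by
      rw [pow_succ, ← Nat.div_div_eq_div_mul]
      exact (Nat.div_add_mod _ 2).symm
    have hmod : N / 2 ^ (i : ℕ) % 2 = 0 ∨ N / 2 ^ (i : ℕ) % 2 = 1 := Nat.mod_two_eq_zero_or_one _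
    rw [hdig, ladderSign]
    rcases neg <;> rcases hmod with h | h <;> simp [h] <;> ring

/-- The value of the ladder at its source: `Q u_0 = ± N`. [cite: HuttenhainIkenmeyer2016, Prop. 2.2 (proof)] -/
theorem ladderQ_source (hlo : 2 ^ k ≤ N) (hhi : N < 2 ^ (k + 1)) :
    ladderQ k N neg σ (Sum.inl 0) = C (ladderSign neg * (N : ℤ)) := by
  have h := ladderQ_level k N neg σ hlo hhi k 0 (by simp)
  simpa using h

end LadderValues

/-- Path values are invariant under relabelling the vertices. [folklore] -/
private theorem pathValue_reindex {V W : Type*} [Fintype V] [DecidableEq V] [Fintype W]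
    [DecidableEq W] {R : Type*} [CommRing R] (e : V ≃ W) (E : Matrix V V R) (s t : V) :
    pathValue (Matrix.reindex e e E) (e s) (e t) = pathValue E s t := by
  unfold pathValue
  rw [Fintype.card_congr e]
  refine sum_congr rfl fun ℓ _ => ?_
  have hpow : (Matrix.reindex e e E) ^ (ℓ + 1) = Matrix.reindex e e (E ^ (ℓ + 1)) := by
    have := map_pow (Matrix.reindexAlgEquiv R R e) E (ℓ + 1)
    simpa only [Matrix.coe_reindexAlgEquiv] using this.symm
  rw [hpow, Matrix.reindex_apply, Matrix.submatrix_apply, e.symm_apply_apply, e.symm_apply_apply]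

/-- A binary ABP stays a binary ABP under relabelling the vertices. [folklore] -/
private theorem isBinaryABP_reindex {V W : Type*} [Fintype V] [DecidableEq V] [Fintype W]
    [DecidableEq W] {σ : Type*} {E : Matrix V V (MvPolynomial σ ℤ)} {s t : V}
    (h : IsBinaryABP E s t) (e : V ≃ W) : IsBinaryABP (Matrix.reindex e e E) (e s) (e t) where
  binary := h.binary.submatrix _ _
  acyclic := by
    obtain ⟨rk, hrk⟩ := h.acyclic
    exact ⟨rk ∘ e.symm, fun u v huv => hrk _ _ huv⟩
  source_ne_target := fun hst => h.source_ne_target (e.injective hst)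
  eq_zero_to_source := fun u => by
    rw [Matrix.reindex_apply, Matrix.submatrix_apply, e.symm_apply_apply]
    exact h.eq_zero_to_source _
  eq_zero_from_target := fun v => by
    rw [Matrix.reindex_apply, Matrix.submatrix_apply, e.symm_apply_apply]
    exact h.eq_zero_from_target _

end HuttenhainIkenmeyer

section PropFiveHolds

variable {σ : Type*}

/-- **Proposition 2.2, discharged** (Hüttenhain–Ikenmeyer 2016, §2, p0004:L20), with the explicit
constant `K = 4`: for every `c ≠ 0` the ladder of `HuttenhainIkenmeyer.ladder` on
`4 ⌊log₂ |c|⌋ + 3` vertices is a binary ABP with all labels `1` and path value `c`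
(`HuttenhainIkenmeyer.ladderQ_source`). [cite: HuttenhainIkenmeyer2016, Prop. 2.2] -/
theorem huttenhainIkenmeyer2016_prop5_holds : huttenhainIkenmeyer2016_prop5 (σ := σ) := by
  refine ⟨4, fun c hc => ?_⟩
  have hN : c.natAbs ≠ 0 := Int.natAbs_ne_zero.mpr hc
  set N := c.natAbs with hNdef
  set k := Nat.log 2 N with hkdef
  set neg : Bool := decide (c < 0) with hneg
  have hlo : 2 ^ k ≤ N := Nat.pow_log_le_self 2 hN
  have hhi : N < 2 ^ (k + 1) := Nat.lt_pow_succ_log_self (by norm_num) N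
  have hcard : Fintype.card (HuttenhainIkenmeyer.LadderV k) = 4 * k + 3 := by
    simp only [Fintype.card_sum, Fintype.card_fin, Fintype.card_unit]
    ring
  obtain ⟨e⟩ : Nonempty (HuttenhainIkenmeyer.LadderV k ≃ Fin (4 * k + 3)) :=
    ⟨Fintype.equivFinOfCardEq hcard⟩
  refine ⟨4 * k + 3, Matrix.reindex e e (HuttenhainIkenmeyer.ladder k N neg σ), e (Sum.inl 0),
    e (HuttenhainIkenmeyer.ladderT k),
    HuttenhainIkenmeyer.isBinaryABP_reindex (HuttenhainIkenmeyer.isBinaryABP_ladder k N neg) e,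
    fun u v => HuttenhainIkenmeyer.ladder_apply_eq_zero_or_one k N neg _ _, by omega, ?_⟩
  rw [HuttenhainIkenmeyer.pathValue_reindex]
  have h := HuttenhainIkenmeyer.ladderQ_source k N neg σ hlo hhi
  simp only [HuttenhainIkenmeyer.ladderQ] at h
  rw [h, HuttenhainIkenmeyer.ladderSign]
  congr 1
  by_cases hlt : c < 0
  · have hn : neg = true := by rw [hneg]; exact decide_eq_true hlt
    rw [if_pos hn, hNdef]
    omega
  · have hn : ¬neg = true := by rw [hneg]; simp [hlt]
    rw [if_neg hn, hNdef]
    omega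

end PropFiveHolds

end Constants

/-! ## §2, Proposition 2.3: integer variable matrices (discharge)

Hüttenhain–Ikenmeyer 2016, Prop. 2.3 (p0004:L32–p0005:L47): replace every integer entry
`c ∉ {0, 1}` of `C` by the program of Prop. 2.2 — remove the edge `(i, j)`, add edges `i → s`,
`t → j` of label `1` and loops of label `1` on the vertices of the program. The printed proof
compares cycle covers; here the block matrix
`A = [[C₀, B], [B', 1 + E]]` (`C₀` = `C` with the bad entries removed, `E` = the disjoint union of
the programs, `B`, `B'` the connecting edges) has `det A = det (1 + E) · det (C₀ − B (1+E)⁻¹ B')`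
(Schur complement, `Matrix.det_fromBlocks₂₂`), `det (1 + E) = 1`, and
`(B (1 + E)⁻¹ B')_{ij} = ((1 + E_{ij})⁻¹)_{s t} = −(path value) = −c_{ij}`, so the Schur
complement is `C` itself. For a uniform index type we attach a (disconnected, harmless) program
to every position and give all programs `⌊log₂ c_max⌋ + 1` levels (`ladderQ_level'`), which
yields the size `n + n² (4 ⌊log₂ c_max⌋ + 3) ≤ n + 4 n² (⌊log₂ c_max⌋ + 1)`. -/

section IntegerEntries

namespace HuttenhainIkenmeyer

section LadderValues'

variable (k N : ℕ) (neg : Bool) (σ : Type*)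

/-- Values at the levels, `Q u_i = ± ⌊N / 2^i⌋`, assuming only `N < 2^{k+1}` (the top digits may
vanish; used for the uniform gadgets of Prop. 2.3).
[cite: HuttenhainIkenmeyer2016, Prop. 2.2 (proof)] -/
theorem ladderQ_level' (hhi : N < 2 ^ (k + 1)) :
    ∀ d (i : Fin (k + 1)), (i : ℕ) + d = k →
      ladderQ k N neg σ (Sum.inl i) = C (ladderSign neg * ((N / 2 ^ (i : ℕ) : ℕ) : ℤ)) := by
  have ht := ladderQ_target k N neg σ
  have he := ladderQ_exit k N neg σ
  simp only [ladderQ, ladderT] at ht he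
  -- the recursion at a level vertex
  have hrec : ∀ i : Fin (k + 1), ladderQ k N neg σ (Sum.inl i) =
      (if (!neg && decide (N / 2 ^ (i : ℕ) % 2 = 1)) = true then 1 else 0) -
        ((∑ j : Fin k, if (i : ℕ) = j then ladderQ k N neg σ (Sum.inr (Sum.inl (Sum.inl j))) else 0) +
         (∑ j : Fin k, if (i : ℕ) = j then ladderQ k N neg σ (Sum.inr (Sum.inl (Sum.inr j))) else 0) +
         (if (neg && decide (N / 2 ^ (i : ℕ) % 2 = 1)) = true then 1 else 0)) := by
    intro i
    have piece_u : ∑ i' : Fin (k + 1), ladder k N neg σ (Sum.inl i) (Sum.inl i') *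
        pathValue (ladder k N neg σ) (Sum.inl i') (ladderT k) = 0 :=
      sum_eq_zero fun i' _ => by simp [ladder_apply, ladderAdj]
    have piece_ab : ∀ lr : Bool, ∑ j : Fin k,
        ladder k N neg σ (Sum.inl i) (Sum.inr (Sum.inl (cond lr (Sum.inl j) (Sum.inr j)))) *
          pathValue (ladder k N neg σ) (Sum.inr (Sum.inl (cond lr (Sum.inl j) (Sum.inr j))))
            (ladderT k) =
        ∑ j : Fin k, if (i : ℕ) = j then
          ladderQ k N neg σ (Sum.inr (Sum.inl (cond lr (Sum.inl j) (Sum.inr j)))) else 0 := by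
      intro lr
      refine sum_congr rfl fun j _ => ?_
      rcases lr <;> simp [ladder_apply, ladderAdj, ladderQ, ladderT]
    have piece_e : ∑ i' : Fin (k + 1), ladder k N neg σ (Sum.inl i) (Sum.inr (Sum.inr (Sum.inl i'))) *
        pathValue (ladder k N neg σ) (Sum.inr (Sum.inr (Sum.inl i'))) (ladderT k) =
        if (neg && decide (N / 2 ^ (i : ℕ) % 2 = 1)) = true then 1 else 0 := by
      rw [Fintype.sum_eq_single i]
      · rw [he, mul_one, ladder_apply]
        simp [ladderAdj]
      · intro i' hi'
        rw [ladder_apply, if_neg, zero_mul]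
        simp only [ladderAdj, Bool.and_eq_true, decide_eq_true_eq]
        rintro ⟨⟨-, h⟩, -⟩
        exact hi' h.symm
    have piece_t : ∀ u : Unit, ladder k N neg σ (Sum.inl i) (Sum.inr (Sum.inr (Sum.inr u))) *
        pathValue (ladder k N neg σ) (Sum.inr (Sum.inr (Sum.inr u))) (ladderT k) = 0 := by
      intro u
      rw [show Sum.inr (Sum.inr (Sum.inr u)) = ladderT k from rfl, ht, mul_zero]
    have ha := piece_ab true
    have hb := piece_ab false
    simp only [cond_true, cond_false] at ha hb
    rw [ladderQ, pathValue_eq_sub_sum (ladder_ranked k N neg σ), Fintype.sum_sum_type,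
      Fintype.sum_sum_type, Fintype.sum_sum_type, Fintype.sum_sum_type, piece_u, ha, hb, piece_e,
      Fintype.sum_eq_zero _ piece_t, zero_add, add_zero, ladder_apply]
    simp [ladderAdj]
  -- the top digit is `⌊N / 2^k⌋ ∈ {0, 1}`
  have hdiv : N / 2 ^ k = 0 ∨ N / 2 ^ k = 1 := by
    have h2 : N / 2 ^ k < 2 := Nat.div_lt_of_lt_mul (by rwa [pow_succ] at hhi)
    exact Nat.le_one_iff_eq_zero_or_eq_one.mp (Nat.lt_succ_iff.mp h2)
  intro d
  induction d with
  | zero =>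
    intro i hi
    rw [add_zero] at hi
    rw [hrec]
    have hnone : ∀ (lr : Bool), (∑ j : Fin k, if (i : ℕ) = j then
        ladderQ k N neg σ (Sum.inr (Sum.inl (cond lr (Sum.inl j) (Sum.inr j)))) else 0) = 0 :=
      fun lr => sum_eq_zero fun j _ => if_neg (by rw [hi]; exact (ne_of_gt j.isLt))
    have ha := hnone true
    have hb := hnone false
    simp only [cond_true, cond_false] at ha hb
    rw [ha, hb, zero_add, zero_add, hi, ladderSign]
    rcases hdiv with h | h <;> rw [h] <;> rcases neg <;> simp
  | succ d ih =>
    intro i hi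
    have hik : (i : ℕ) < k := by omega
    have hIH := ih ⟨(i : ℕ) + 1, by omega⟩ (by simp only; omega)
    rw [hrec]
    have hsum : ∀ (lr : Bool), (∑ j : Fin k, if (i : ℕ) = j then
        ladderQ k N neg σ (Sum.inr (Sum.inl (cond lr (Sum.inl j) (Sum.inr j)))) else 0) =
        -ladderQ k N neg σ (Sum.inl ⟨(i : ℕ) + 1, by omega⟩) := by
      intro lr
      rw [Fintype.sum_eq_single (⟨i, hik⟩ : Fin k) (fun j hj => if_neg fun h =>
        hj (Fin.ext h.symm)), if_pos rfl, ladderQ_mid]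
      rfl
    have ha := hsum true
    have hb := hsum false
    simp only [cond_true, cond_false] at ha hb
    rw [ha, hb, hIH]
    -- arithmetic: digit + 2 · ⌊N/2^{i+1}⌋ = ⌊N/2^i⌋
    have hdig : N / 2 ^ (i : ℕ) = 2 * (N / 2 ^ ((i : ℕ) + 1)) + N / 2 ^ (i : ℕ) % 2 := by
      rw [pow_succ, ← Nat.div_div_eq_div_mul]
      exact (Nat.div_add_mod _ 2).symm
    have hmod : N / 2 ^ (i : ℕ) % 2 = 0 ∨ N / 2 ^ (i : ℕ) % 2 = 1 := Nat.mod_two_eq_zero_or_one _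
    rw [hdig, ladderSign]
    rcases neg <;> rcases hmod with h | h <;> simp [h] <;> ring


end LadderValues'

section Generic

variable {V : Type*} [Fintype V] [DecidableEq V] {R : Type*} [CommRing R]
variable {E : Matrix V V R} {rk : V → ℕ}

/-- Powers beyond `|V|` vanish for a ranked digraph. [folklore] -/
private theorem pow_eq_zero_of_card_le (hrk : ∀ u v, E u v ≠ 0 → rk u < rk v) {i : ℕ}
    (hi : Fintype.card V ≤ i) : E ^ i = 0 := by
  rw [← Nat.add_sub_cancel' hi, pow_add, pow_card_eq_zero hrk, zero_mul]

/-- The alternating power sum over any range `≥ |V|` is `altPowSum`. [folklore] -/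
private theorem sum_range_eq_altPowSum (hrk : ∀ u v, E u v ≠ 0 → rk u < rk v) {L : ℕ}
    (hL : Fintype.card V ≤ L) : ∑ i ∈ range L, (-1 : R) ^ i • E ^ i = altPowSum E := by
  rw [altPowSum, ← Finset.sum_subset (Finset.range_subset_range.mpr hL)]
  intro i hi hi'
  rw [mem_range, not_lt] at hi'
  rw [pow_eq_zero_of_card_le hrk hi', smul_zero]

end Generic

section Gadgets

variable {σ : Type*} {n : ℕ} (M : Matrix (Fin n) (Fin n) (MvPolynomial σ ℤ)) (cmax : ℕ)

/-- The integer constant `c ∉ {0, 1}` of an entry of `M`, if the entry is one (classical choice;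
`none` otherwise). [cite: HuttenhainIkenmeyer2016, Prop. 2.3 (proof)] -/
def badConst (q : Fin n × Fin n) : Option ℤ :=
  @dite _ (∃ c : ℤ, M q.1 q.2 = C c ∧ c ≠ 0 ∧ c ≠ 1) (Classical.dec _) (fun h => some h.choose)
    fun _ => none

/-- Specification of `badConst` (`some`). [cite: HuttenhainIkenmeyer2016, Prop. 2.3 (proof)] -/
theorem badConst_spec {q : Fin n × Fin n} {c : ℤ} (h : badConst M q = some c) :
    M q.1 q.2 = C c ∧ c ≠ 0 ∧ c ≠ 1 := by
  unfold badConst at h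
  split_ifs at h with hq
  · cases h
    exact hq.choose_spec
  
/-- Specification of `badConst` (`none`). [cite: HuttenhainIkenmeyer2016, Prop. 2.3 (proof)] -/
theorem badConst_eq_none {q : Fin n × Fin n} (h : badConst M q = none) :
    ¬∃ c : ℤ, M q.1 q.2 = C c ∧ c ≠ 0 ∧ c ≠ 1 := by
  unfold badConst at h
  split_ifs at h with hq
  exact hq

/-- The number of levels of the (uniform) gadgets: `⌊log₂ c_max⌋`.
[cite: HuttenhainIkenmeyer2016, Prop. 2.3 (proof)] -/
abbrev gadgetLevels : ℕ := Nat.log 2 cmax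

/-- The constant realised by the gadget at position `q` (`0` for a good position, whose gadget
is disconnected). [cite: HuttenhainIkenmeyer2016, Prop. 2.3 (proof)] -/
def gadgetConst (q : Fin n × Fin n) : ℤ := (badConst M q).getD 0

/-- The gadget at position `q`: the ladder of Prop. 2.2 for `gadgetConst M q` with
`⌊log₂ c_max⌋ + 1` levels. [cite: HuttenhainIkenmeyer2016, Prop. 2.3 (proof)] -/
def gadget (q : Fin n × Fin n) :
    Matrix (LadderV (gadgetLevels cmax)) (LadderV (gadgetLevels cmax)) (MvPolynomial σ ℤ) :=
  ladder (gadgetLevels cmax) (gadgetConst M q).natAbs (decide (gadgetConst M q < 0)) σ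

/-- Each gadget is ranked by `ladderRank`. [cite: HuttenhainIkenmeyer2016, Prop. 2.3 (proof)] -/
theorem gadget_ranked (q : Fin n × Fin n) : ∀ x y, gadget M cmax q x y ≠ 0 →
    ladderRank (gadgetLevels cmax) x < ladderRank (gadgetLevels cmax) y :=
  ladder_ranked _ _ _ σ

/-- All gadgets together (disjoint union = block diagonal adjacency matrix).
[cite: HuttenhainIkenmeyer2016, Prop. 2.3 (proof)] -/
def gadgets : Matrix (LadderV (gadgetLevels cmax) × (Fin n × Fin n))
    (LadderV (gadgetLevels cmax) × (Fin n × Fin n)) (MvPolynomial σ ℤ) :=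
  Matrix.blockDiagonal fun q => gadget M cmax q

/-- The disjoint union of the gadgets is ranked. [cite: HuttenhainIkenmeyer2016, Prop. 2.3 (proof)] -/
theorem gadgets_ranked : ∀ x y, gadgets M cmax x y ≠ 0 →
    ladderRank (gadgetLevels cmax) x.1 < ladderRank (gadgetLevels cmax) y.1 := by
  rintro ⟨v, q⟩ ⟨v', q'⟩ h
  rw [gadgets, Matrix.blockDiagonal_apply'] at h
  by_cases hq : q = q'
  · subst hq
    rw [if_pos rfl] at h
    exact gadget_ranked M cmax q v v' h
  · exact absurd (if_neg hq) h

/-- `C` with its bad entries removed. [cite: HuttenhainIkenmeyer2016, Prop. 2.3 (proof)] -/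
def goodPart : Matrix (Fin n) (Fin n) (MvPolynomial σ ℤ) :=
  fun i j => if (badConst M (i, j)).isSome then 0 else M i j

/-- The edges `i → s_{(i,j)}` (label `1`) into the gadgets of the bad entries of row `i`.
[cite: HuttenhainIkenmeyer2016, Prop. 2.3 (proof)] -/
def toGadgets : Matrix (Fin n) (LadderV (gadgetLevels cmax) × (Fin n × Fin n)) (MvPolynomial σ ℤ) :=
  fun i x => if x.2.1 = i ∧ x.1 = Sum.inl 0 ∧ (badConst M x.2).isSome then 1 else 0

/-- The edges `t_{(i,j)} → j` (label `1`) out of the gadgets of the bad entries of column `j`.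
[cite: HuttenhainIkenmeyer2016, Prop. 2.3 (proof)] -/
def fromGadgets : Matrix (LadderV (gadgetLevels cmax) × (Fin n × Fin n)) (Fin n) (MvPolynomial σ ℤ) :=
  fun x j => if x.2.2 = j ∧ x.1 = ladderT (gadgetLevels cmax) ∧ (badConst M x.2).isSome then 1
    else 0

/-- **The binary variable matrix of Prop. 2.3**: the directed adjacency matrix of the digraph `G`
obtained from `C` by replacing every bad entry by its gadget (with unit loops on the gadget
vertices). [cite: HuttenhainIkenmeyer2016, Prop. 2.3 (proof)] -/
def prop6Matrix : Matrix (Fin n ⊕ LadderV (gadgetLevels cmax) × (Fin n × Fin n))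
    (Fin n ⊕ LadderV (gadgetLevels cmax) × (Fin n × Fin n)) (MvPolynomial σ ℤ) :=
  Matrix.fromBlocks (goodPart M) (toGadgets M cmax) (fromGadgets M cmax) (1 + gadgets M cmax)

/-- The `(s, t)` entry of `(1 + E_q)⁻¹ = altPowSum E_q` for the gadget at a bad position `q` with
constant `c` is `−c`. [cite: HuttenhainIkenmeyer2016, Prop. 2.3 (proof)] -/
theorem altPowSum_gadget_source_target {q : Fin n × Fin n} {c : ℤ} (hq : badConst M q = some c)
    (hc : c.natAbs ≤ cmax) :
    altPowSum (gadget M cmax q) (Sum.inl 0) (ladderT (gadgetLevels cmax)) = -C c := by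
  have hgc : gadgetConst M q = c := by simp [gadgetConst, hq]
  rw [← adjugate_one_add (gadget_ranked M cmax q), adjugate_one_add_apply (gadget_ranked M cmax q)
    Sum.inl_ne_inr]
  unfold gadget
  rw [hgc]
  have hhi : c.natAbs < 2 ^ (gadgetLevels cmax + 1) :=
    lt_of_le_of_lt hc (Nat.lt_pow_succ_log_self (by norm_num) cmax)
  have h := ladderQ_level' (gadgetLevels cmax) c.natAbs (decide (c < 0)) σ hhi
    (gadgetLevels cmax) 0 (by simp)
  have h' : pathValue (ladder (gadgetLevels cmax) c.natAbs (decide (c < 0)) σ) (Sum.inl 0)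
      (ladderT (gadgetLevels cmax)) = C (ladderSign (decide (c < 0)) * ((c.natAbs / 2 ^ 0 : ℕ) : ℤ)) :=
    h
  rw [h', pow_zero, Nat.div_one, ladderSign]
  congr 2
  by_cases hlt : c < 0
  · rw [if_pos (decide_eq_true hlt)]
    omega
  · rw [if_neg (by simp [hlt])]
    omega

/-- **`det` of the Prop. 2.3 matrix is `det C`** (Schur complement).
[cite: HuttenhainIkenmeyer2016, Prop. 2.3 (proof)] -/
theorem det_prop6Matrix
    (hM : ∀ i j, (∃ v, M i j = X v) ∨ ∃ c : ℤ, M i j = C c ∧ c.natAbs ≤ cmax) :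
    (prop6Matrix M cmax).det = M.det := by
  have hrk := gadgets_ranked M cmax (σ := σ)
  have hmul : (1 + gadgets M cmax) * altPowSum (gadgets M cmax) = 1 := one_add_mul_altPowSum hrk
  letI : Invertible (1 + gadgets M cmax) := invertibleOfRightInverse _ _ hmul
  have hinv : ⅟(1 + gadgets M cmax) = altPowSum (gadgets M cmax) := rfl
  rw [prop6Matrix, Matrix.det_fromBlocks₂₂, det_one_add hrk, one_mul, hinv]
  congr 1
  refine Matrix.ext fun i j => ?_
  rw [Matrix.sub_apply, Matrix.mul_apply]
  -- the Schur complement correction at `(i, j)`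
  have hD : ∀ (x y : LadderV (gadgetLevels cmax) × (Fin n × Fin n)),
      altPowSum (gadgets M cmax) x y =
        if x.2 = y.2 then altPowSum (gadget M cmax x.2) x.1 y.1 else 0 := by
    rintro ⟨v, q⟩ ⟨v', q'⟩
    rw [← sum_range_eq_altPowSum hrk le_rfl, Matrix.sum_apply]
    simp only [gadgets, ← Matrix.blockDiagonal_pow, Matrix.smul_apply, Matrix.blockDiagonal_apply',
      Pi.pow_apply]
    by_cases hq : q = q'
    · subst hq
      simp only [if_true]
      rw [← sum_range_eq_altPowSum (gadget_ranked M cmax q) (L := Fintype.card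
        (LadderV (gadgetLevels cmax) × (Fin n × Fin n))) ?_, Matrix.sum_apply]
      · simp only [Matrix.smul_apply]
      · rw [Fintype.card_prod]
        exact Nat.le_mul_of_pos_right _ (Fintype.card_pos_iff.mpr ⟨(i, j)⟩)
    · simp [hq]
  have hBD : ∀ y : LadderV (gadgetLevels cmax) × (Fin n × Fin n),
      (toGadgets M cmax * altPowSum (gadgets M cmax)) i y =
        if y.2.1 = i ∧ (badConst M y.2).isSome then
          altPowSum (gadget M cmax y.2) (Sum.inl 0) y.1 else 0 := by
    rintro ⟨v', q'⟩
    rw [Matrix.mul_apply, Fintype.sum_eq_single ((Sum.inl 0 : LadderV (gadgetLevels cmax)), q')]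
    · rw [hD, if_pos rfl]
      simp only [toGadgets, true_and]
      split_ifs <;> simp
    · rintro ⟨v, q⟩ hx
      rw [hD]
      by_cases hq : q = q'
      · subst hq
        have hv : v ≠ Sum.inl 0 := fun h => hx (by rw [h])
        simp [toGadgets, hv]
      · simp [hq]
  rw [Fintype.sum_eq_single (ladderT (gadgetLevels cmax), (i, j))]
  · rw [hBD, goodPart]
    cases hq : badConst M (i, j) with
    | none => simp [fromGadgets, hq]
    | some c =>
      have hs := badConst_spec M hq
      have hc : c.natAbs ≤ cmax := by
        rcases hM i j with ⟨v, hv⟩ | ⟨c', hc', hle⟩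
        · exfalso
          have h1 := congrArg MvPolynomial.constantCoeff (hv.symm.trans hs.1)
          rw [MvPolynomial.constantCoeff_X, MvPolynomial.constantCoeff_C] at h1
          exact hs.2.1 h1.symm
        · have : c = c' := C_injective σ ℤ (hs.1.symm.trans hc')
          rw [this]
          exact hle
      simp only [fromGadgets, hq, Option.isSome_some, and_true, if_true]
      rw [altPowSum_gadget_source_target M cmax hq hc, show M i j = C c from hs.1]
      ring
  · rintro ⟨v, q⟩ hy
    simp only [fromGadgets]
    split_ifs with h
    · obtain ⟨hq2, hv, -⟩ := h
      rw [hBD]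
      split_ifs with h'
      · exfalso
        apply hy
        subst hv
        have hq' : q = (i, j) := Prod.ext h'.1 hq2
        subst hq'
        rfl
      · exact zero_mul _
    · exact mul_zero _

/-- The Prop. 2.3 matrix is a binary variable matrix (good entries of `C` are variables or `0, 1`;
connecting edges and loops are `1`; gadget labels are `0/1`).
[cite: HuttenhainIkenmeyer2016, Prop. 2.3 (proof)] -/
theorem isBinaryVariableMatrix_prop6Matrix
    (hM : ∀ i j, (∃ v, M i j = X v) ∨ ∃ c : ℤ, M i j = C c ∧ c.natAbs ≤ cmax) :
    IsBinaryVariableMatrix (prop6Matrix M cmax) := by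
  rintro (i | ⟨v, q⟩) (j | ⟨v', q'⟩)
  · simp only [prop6Matrix, Matrix.fromBlocks_apply₁₁, goodPart]
    cases hq : badConst M (i, j) with
    | some c => exact Or.inl (by simp)
    | none =>
      simp only [Option.isSome_none, Bool.false_eq_true, if_false]
      rcases hM i j with ⟨w, hw⟩ | ⟨c, hc, -⟩
      · exact Or.inr (Or.inr ⟨w, hw⟩)
      · have hnot := badConst_eq_none M hq
        have h01 : c = 0 ∨ c = 1 := by
          by_contra h
          rw [not_or] at h
          exact hnot ⟨c, hc, h.1, h.2⟩
        rcases h01 with rfl | rfl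
        · exact Or.inl (by rw [hc, C_0])
        · exact Or.inr (Or.inl (by rw [hc, C_1]))
  · simp only [prop6Matrix, Matrix.fromBlocks_apply₁₂, toGadgets]
    split_ifs
    · exact Or.inr (Or.inl rfl)
    · exact Or.inl rfl
  · simp only [prop6Matrix, Matrix.fromBlocks_apply₂₁, fromGadgets]
    split_ifs
    · exact Or.inr (Or.inl rfl)
    · exact Or.inl rfl
  · simp only [prop6Matrix, Matrix.fromBlocks_apply₂₂, Matrix.add_apply]
    by_cases hxy : ((v, q) : LadderV (gadgetLevels cmax) × (Fin n × Fin n)) = (v', q')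
    · rw [← hxy, Matrix.one_apply_eq, apply_self_eq_zero (gadgets_ranked M cmax), add_zero]
      exact Or.inr (Or.inl rfl)
    · rw [Matrix.one_apply_ne hxy, zero_add, gadgets, Matrix.blockDiagonal_apply']
      split_ifs
      · unfold gadget
        exact (ladder_apply_eq_zero_or_one _ _ _ _ _).imp_right Or.inl
      · exact Or.inl rfl

/-- The number of vertices: `n + n² (4 ⌊log₂ c_max⌋ + 3) ≤ n + 4 n² (⌊log₂ c_max⌋ + 1)`.
[cite: HuttenhainIkenmeyer2016, Prop. 2.3 (proof)] -/
theorem card_prop6Index_le :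
    Fintype.card (Fin n ⊕ LadderV (gadgetLevels cmax) × (Fin n × Fin n)) ≤
      n + 4 * n ^ 2 * (Nat.log 2 cmax + 1) := by
  have hL : Fintype.card (LadderV (gadgetLevels cmax)) = 4 * Nat.log 2 cmax + 3 := by
    simp only [Fintype.card_sum, Fintype.card_fin, Fintype.card_unit, gadgetLevels]
    ring
  rw [Fintype.card_sum, Fintype.card_prod, Fintype.card_prod, Fintype.card_fin, hL]
  calc n + (4 * Nat.log 2 cmax + 3) * (n * n) ≤ n + (4 * (Nat.log 2 cmax + 1)) * (n * n) := by
        gcongr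
        omega
    _ = n + 4 * n ^ 2 * (Nat.log 2 cmax + 1) := by ring

end Gadgets

end HuttenhainIkenmeyer

section PropSixHolds

variable {σ : Type*}

/-- **Proposition 2.3, discharged** (Hüttenhain–Ikenmeyer 2016, §2, p0004:L32), with the explicit
constant `K = 4`: for an `n × n` matrix whose entries are variables or integers of absolute value
`≤ c_max`, the matrix `HuttenhainIkenmeyer.prop6Matrix` (the digraph of `C` with every entry
`∉ {0, 1}` replaced by its Prop. 2.2 program, unit loops on the program vertices) is a binary
variable matrix of size `n + n² (4 ⌊log₂ c_max⌋ + 3) ≤ n + 4 n² (⌊log₂ c_max⌋ + 1)` with the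
same determinant (`HuttenhainIkenmeyer.det_prop6Matrix`, by a Schur complement).
[cite: HuttenhainIkenmeyer2016, Prop. 2.3] -/
theorem huttenhainIkenmeyer2016_prop6_holds : huttenhainIkenmeyer2016_prop6 (σ := σ) := by
  refine ⟨4, fun n cmax M hM => ?_⟩
  refine ⟨Fintype.card (Fin n ⊕ HuttenhainIkenmeyer.LadderV (HuttenhainIkenmeyer.gadgetLevels cmax)
      × (Fin n × Fin n)), HuttenhainIkenmeyer.card_prop6Index_le (n := n) cmax, ?_⟩
  refine ⟨Matrix.reindex (Fintype.equivFin _) (Fintype.equivFin _)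
      (HuttenhainIkenmeyer.prop6Matrix M cmax),
    (HuttenhainIkenmeyer.isBinaryVariableMatrix_prop6Matrix M cmax hM).submatrix _ _, ?_⟩
  rw [Matrix.det_reindex_self, HuttenhainIkenmeyer.det_prop6Matrix M cmax hM]

/-- **Corollary 2.4, unconditional** (Hüttenhain–Ikenmeyer 2016, §2, p0005:L48): every integer
polynomial is the determinant of a binary variable matrix (`huttenhainIkenmeyer2016_cor7` fed
with `huttenhainIkenmeyer2016_prop6_holds`). [cite: HuttenhainIkenmeyer2016, Cor. 2.4] -/
theorem huttenhainIkenmeyer2016_cor7_holds (f : MvPolynomial σ ℤ) : ∃ n, HasBinaryDetRepr f n :=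
  huttenhainIkenmeyer2016_cor7 huttenhainIkenmeyer2016_prop6_holds f

/-- The infimum defining `bdc f` is attained: `f` is the determinant of a binary variable matrix
of size exactly `bdc f` (Cor. 2.4 makes the defining set nonempty; Hüttenhain–Ikenmeyer 2016, §1).
[cite: HuttenhainIkenmeyer2016, §1] -/
theorem hasBinaryDetRepr_binaryDetComplexity (f : MvPolynomial σ ℤ) :
    HasBinaryDetRepr f (binaryDetComplexity f) :=
  Nat.sInf_mem (s := {n : ℕ | HasBinaryDetRepr f n}) (huttenhainIkenmeyer2016_cor7_holds f)

/-- `HasBinaryDetRepr f n ↔ bdc f ≤ n` (padding, `HasBinaryDetRepr.mono`).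
[cite: HuttenhainIkenmeyer2016, §1] -/
theorem hasBinaryDetRepr_iff_binaryDetComplexity_le (f : MvPolynomial σ ℤ) (n : ℕ) :
    HasBinaryDetRepr f n ↔ binaryDetComplexity f ≤ n :=
  ⟨binaryDetComplexity_le_of_hasBinaryDetRepr,
    fun h => (hasBinaryDetRepr_binaryDetComplexity f).mono h⟩

/-- `dc f ≤ bdc f` over `ℤ` (a binary variable matrix is an affine determinantal representation;
Hüttenhain–Ikenmeyer 2016, §1: `dc` is "a stronger model of computation").
[cite: HuttenhainIkenmeyer2016, §1] -/
theorem determinantalComplexity_le_binaryDetComplexity (f : MvPolynomial σ ℤ) :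
    determinantalComplexity f ≤ binaryDetComplexity f :=
  determinantalComplexity_le_of_hasBinaryDetRepr (hasBinaryDetRepr_binaryDetComplexity f)

end PropSixHolds

end IntegerEntries

end Literature.Computability.AlgebraicComplexity

end
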